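import Literature.Analysis.FluidPDE.TypeIAncientMild
import Literature.Analysis.FluidPDE.KNSSTypeIRateMildProofs
import Summits.NavierStokesRegularity.NavierStokesRegularity.Theorems.MustSqueeze.Negative.GaussianVortex
import Summits.NavierStokesRegularity.NavierStokesRegularity.Theorems.SqueezeCycleExtremalBiaxialitySubcriticalSmallConstant
import Literature.Analysis.FluidPDE.HessianLaplacian
import Literature.Analysis.FluidPDE.ClassicalSolution

/-!
# Disproof of `FarPastLedger` (crux stmt-NavierStokesRegularity-14060, route SymmetryModuliCount) — findings

WORK FILE of the standing crux disprover (cdisprove, D-0016).  Prose only in docstrings.  v4 (cycle 2,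
gen-2 seat), 2026-08-16.  v1–v3: crux-level attacks (§1–§7); v4: the PICKED LINE `uloc-gronwall-transplant` (§8).

VERDICT SO FAR: NO KILL — and none is possible by an explicit field: `¬ FarPastLedger` exhibits a
NONZERO Type-I KNSS-mild ancient solution (§3), i.e. it refutes the route target X itself and the
Seregin–Šverák / KNSS Type-I Liouville conjecture.  What the file gives the provers instead:

* §1 READ-BACK. `FarPastLedgerSig` = verbatim body of the route decl (the farm olean of the route
  module lags rev ≥ 7: `FarPastLedger` is "Unknown identifier" there; the bridge is `Iff.rfl` once it
  is rebuilt).  No junk: the integrand is continuous on a bounded ball (true integral), `‖·‖ ^ 2` is the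
  `ℕ`-power, `C < 0` ⇒ class empty, `u ≡ 0 ∈ A_C` for `C ≥ 0` (so `K ≥ 0` is forced, harmless).
* §3 WHY IT RESISTS. `X ⇒ crux` with `K = 0` (`farPastLedgerSig_of_classLiouville`,
  `classLiouville_iff_typeIAncientLiouvilleSig`); `¬crux ⇒` a nonzero element of some `A_C` with `C > ε`
  (`exists_large_witness_of_not_farPastLedgerSig`, via the tree's small-constant Liouville theorem
  `exists_typeIAncientMild_eq_zero_of_small`): the crux is trivially TRUE in the perturbative regime.
* §4 TRIVIAL REGIME. `ledger_parabolic_interior`: `∫_{B_R(x₀)}|u(t)|² ≤ C²V₁·R` whenever `R² ≤ −t`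
  (Type-I bound alone).  The content is `R ≫ √(−t)`.
* §5 LOAD-BEARING (any proof must use them): the Oseen/KNSS mild clause
  (`farPastLedger_false_without_mild`: parasitic `(1−t)⁻¹e₀`, energy `R³V₁/4`); the Type-I RATE
  (`farPastLedger_false_without_typeI`: false on KNSS's bounded ancient mild class — constants);
  ANCIENTNESS (`farPastLedger_false_on_window`: false for the Type-I mild class on the final window
  `(−1,0)`, constants with `C = 1` — precisely AlbrittonBarker2019 Rem. 3.2's setting; the crux's bet
  is the entry time `−4R²`, which only ancient elements have).  Not cheaply testable: div-free
  (redundant given mild + bounded: `div u(t) = e^{(t−s)Δ} div u(s) → 0` as `s → −∞`; informal) and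
  smoothness (KNSS Prop. 4.1).
* §6 SCALING. `isTypeIAncientMild_nsRescale` (`A_C` is EXACTLY scale-invariant; assembled from the
  tree's `oseen_smul_stPull`, `IsDivFree.comp_smul`, `HasTypeITimeDecay.nsRescale`),
  `isTypeIAncientMild_translate`, `setIntegral_ball_nsRescale` (energy scaling law).  REDUCTIONS:
  crux ⇔ `LedgerAtNegOne` (ONE time slice `t = −1`) ⇔ `LedgerUnitBalls` ⇔ `LedgerUnitBall` ⇔
  `LedgerUnitBallNearZero` (`sup_{u ∈ A_C, −1 < t < 0} ∫_{B₁(0)}|u(t)|² < ∞`: NO LOCAL-ENERGY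
  CONCENTRATION as `t → 0⁻` on the final unit window of ANCIENT elements — Albritton–Barker's `A(1)`;
  the same window statement for non-ancient elements is `farPastLedger_false_on_window`).  EXPONENT RIGIDITY
  (`farPastLedgerExp_iff_classLiouville`): for every `a ≠ 1`, "`∫_{B_R}|u(t)|² ≤ K(C)·R^a` uniformly"
  ⇔ X.  The Leray exponent is the unique contentful one; the strengthening `a < 1` and the `t`-uniform
  volume bound `a = 3` are both X in costume (so: do not try to "first prove a weaker exponent
  uniformly" — every uniform exponent other than 1 is already the target).
* §7 PAPER AUDIT (docstring `paperAudit`): AB2019 Rem. 3.2 read verbatim — the crux (in its unit-ball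
  form) is exactly the clause AB call "not apparent", for ancient solutions included; their obstruction is
  the forward viewpoint.  The card's entry-time bootstrap, rescaled to the unit ball as an induction on
  levels `(−τ)⁻¹ → (−τ)^{−1/2} → log → bounded`, closes on paper with NO lost logarithm (the dyadic
  far-pressure split is essential).  Verdict of the adversary: very likely TRUE, provable M–L.
* §8 LINE `uloc-gronwall-transplant` (picked; skeleton sha d1056eeb, 7 stubs): §8a STUB AUDIT — all seven
  stubs TRUE as stated, none misstated, joint sufficiency kernel-checked; §8b X-SAFETY — LFL, GRADP, MD,
  PIN each FOLLOW from Liouville over the class (`stubLFL_of_classLiouville`, …: the classical pressure of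
  the zero velocity has `∇p = 0`), so like the crux they admit no explicit counterexample; §8c the
  gradient bound `‖∇q‖ ≤ L` of HA is LOAD-BEARING (`slicePressure_false_without_gradBound`: `w = 0`,
  `q = y₀y₁`; core `no_nearFar_decomposition_harmonicQuadratic`) — HA must consume GRADP; div-free is
  load-bearing in HA too (informal oscillatory witness in §8a).
* `-- Targets`: payload.targets = []; the seven stubs attacked as targets, none broken (table at the end).
* LANDED: `Theorems/FarPastLedger/Negative/LoadBearing.lean` (p80826, §4–§5).  PROPOSED this cycle:
  `Negative/Scaling.lean` (p85515; §3, §6), `Negative/SlicePressure.lean` (p84887; §8c), `Negative/XSafeStubs.lean`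
  (p85260; §8b).
-/

noncomputable section

namespace Summit.NavierStokesRegularity.NavierStokesRegularity.Cruxes.FarPastLedger.Disproof

open MeasureTheory Set Filter Metric
open scoped Topology Laplacian
open Literature.Analysis.FluidPDE Literature.Analysis.UnboundedOperators
open Summit.NavierStokesRegularity.NavierStokesRegularity.Theorems.MustSqueeze.Negative (e0 V1 V1_nonneg
  volume_ball_toReal)

/- NOTE. This file deliberately does NOT import the route module `Theses.SymmetryModuliCount`: the
farm's olean of that module is stale/incoherent at rev ≥ 7 (`FarPastLedger` unknown there), which
makes every importer unservable.  The two route declarations used are mirrored VERBATIM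
(`FarPastLedgerSig`, `TypeIAncientLiouvilleSig`); the bridges are `Iff.rfl`. -/

set_option linter.dupNamespace false

local notation "ℝ³" => EuclideanSpace ℝ (Fin 3)

/-! ## §1 Read-back: verbatim mirror of the route declaration -/

/-- VERBATIM the body of `Theses.SymmetryModuliCount.FarPastLedger` (stmt-14060). -/
def FarPastLedgerSig : Prop :=
  ∀ C : ℝ, ∃ K : ℝ, ∀ (u : ℝ → ℝ³ → ℝ³), IsTypeIAncientMild C u → ∀ t < 0, ∀ (x₀ : ℝ³) (R : ℝ), 0 < R →
    ∫ x in Metric.ball x₀ R, ‖u t x‖ ^ 2 ≤ K * R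

/-! ## §2 Two measure-theoretic one-liners -/

/-- `0 < V₁ = |B₁|`. -/
theorem V1_pos : 0 < V1 :=
  ENNReal.toReal_pos (measure_ball_pos volume (0 : ℝ³) one_pos).ne' measure_ball_lt_top.ne

/-- `∫_{B_R(x₀)} c = c · R³ V₁`. -/
theorem setIntegral_ball_const (x₀ : ℝ³) {R : ℝ} (hR : 0 < R) (c : ℝ) :
    ∫ _x in ball x₀ R, c = c * (R ^ 3 * V1) := by
  rw [setIntegral_const, smul_eq_mul, measureReal_def, volume_ball_toReal x₀ hR, mul_comm]

/-! ## §3 WHY IT RESISTS: the crux follows from the route target `X`; any refutation is a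
nonzero Type-I KNSS-mild ancient solution -/

/-- Liouville over the class: every element of every `A_C` vanishes on `t < 0`. -/
def ClassLiouville : Prop :=
  ∀ (C : ℝ) (u : ℝ → ℝ³ → ℝ³), IsTypeIAncientMild C u → ∀ t < 0, ∀ x, u t x = 0

/-- VERBATIM the body of the route target `Theses.SymmetryModuliCount.TypeIAncientLiouville` (X). -/
def TypeIAncientLiouvilleSig : Prop :=
  ∀ (C : ℝ) (u : ℝ → EuclideanSpace ℝ (Fin 3) → EuclideanSpace ℝ (Fin 3)), ContDiffOn ℝ (⊤ : ℕ∞) (Function.uncurry u) (Set.Iio 0 ×ˢ Set.univ) ∧ (∀ t < 0, Literature.Analysis.FluidPDE.VectorCalculus.IsDivFree (u t)) ∧ (∀ s t : ℝ, s < t → t < 0 → ∀ x, u t x = Literature.Analysis.FluidPDE.heatFlow (u s) (t - s) x - ∫ τ in Set.Ioo s t, ∫ y, Literature.Analysis.FluidPDE.oseenKernel (t - τ) (x - y) (u τ y) (u τ y)) ∧ Literature.Analysis.FluidPDE.HasTypeITimeDecay C u → ∀ t < 0, ∀ x, u t x = 0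

/-- `ClassLiouville` is the route target `TypeIAncientLiouville` (= X) read through
`isTypeIAncientMild_iff`. -/
theorem classLiouville_iff_typeIAncientLiouvilleSig : ClassLiouville ↔ TypeIAncientLiouvilleSig := by
  refine forall_congr' fun C => forall_congr' fun u => ?_
  rw [isTypeIAncientMild_iff]

/-- **X ⇒ crux** with `K = 0`. Hence `¬ crux ⇒ ¬ X`: a refutation of the ledger kills the route
target itself. -/
theorem farPastLedgerSig_of_classLiouville (hL : ClassLiouville) : FarPastLedgerSig := by
  intro C
  refine ⟨0, fun u hu t ht x₀ R _ => ?_⟩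
  have h0 : ∀ x, ‖u t x‖ ^ 2 = 0 := fun x => by rw [hL C u hu t ht x, norm_zero]; ring
  simp only [h0, integral_zero, zero_mul, le_refl]

/-- **Any counterexample is a NONZERO element of some `A_C`**, i.e. a nontrivial Type-I ancient mild
solution in the KNSS gauge — whose existence is the open Type-I Liouville problem (KNSS2009 §6,
SereginSverak2009 Conj. (L), BradshawTsai2017 OP 5.1).  No explicit field can refute the crux. -/
theorem exists_ne_zero_of_not_farPastLedgerSig (h : ¬ FarPastLedgerSig) :
    ∃ (C : ℝ) (u : ℝ → ℝ³ → ℝ³), IsTypeIAncientMild C u ∧ ∃ t < 0, ∃ x, u t x ≠ 0 := by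
  by_contra hne
  push Not at hne
  exact h (farPastLedgerSig_of_classLiouville fun C u hu t ht x => hne C u hu t ht x)

/-- **Perturbative regime is trivially true**: for `C ≤ ε` the class is `{0}` (tree theorem
`exists_typeIAncientMild_eq_zero_of_small`), so the crux restricted to small constants holds with
`K = 0`; its content sits at large `C`. -/
theorem farPastLedgerSig_smallConstant :
    ∃ ε : ℝ, 0 < ε ∧ ∀ C ≤ ε, ∃ K : ℝ, ∀ (u : ℝ → ℝ³ → ℝ³), IsTypeIAncientMild C u →
      ∀ t < 0, ∀ (x₀ : ℝ³) (R : ℝ), 0 < R → ∫ x in ball x₀ R, ‖u t x‖ ^ 2 ≤ K * R := by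
  obtain ⟨ε, hε, h⟩ :=
    Summit.NavierStokesRegularity.NavierStokesRegularity.Theorems.exists_typeIAncientMild_eq_zero_of_small
  refine ⟨ε, hε, fun C hC => ⟨0, fun u hu t ht x₀ R _ => ?_⟩⟩
  have h0 : ∀ x, ‖u t x‖ ^ 2 = 0 := fun x => by rw [h C u hu hC t ht x, norm_zero]; ring
  simp only [h0, integral_zero, zero_mul, le_refl]

/-- Sharper witness extraction: a counterexample constant is LARGE (`C > ε`). -/
theorem exists_large_witness_of_not_farPastLedgerSig (h : ¬ FarPastLedgerSig) :
    ∃ ε : ℝ, 0 < ε ∧ ∃ C : ℝ, ε < C ∧ ∀ K : ℝ, ∃ (u : ℝ → ℝ³ → ℝ³), IsTypeIAncientMild C u ∧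
      ∃ t < 0, ∃ (x₀ : ℝ³) (R : ℝ), 0 < R ∧ K * R < ∫ x in ball x₀ R, ‖u t x‖ ^ 2 := by
  obtain ⟨ε, hε, hsmall⟩ := farPastLedgerSig_smallConstant
  unfold FarPastLedgerSig at h
  push Not at h
  obtain ⟨C, hC⟩ := h
  refine ⟨ε, hε, C, ?_, hC⟩
  by_contra hle
  push Not at hle
  obtain ⟨K, hK⟩ := hsmall C hle
  obtain ⟨u, hu, t, ht, x₀, R, hR, hlt⟩ := hC K
  exact absurd (hK u hu t ht x₀ R hR) (not_le.2 hlt)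

/-! ## §4 TRIVIAL REGIME: the parabolic interior `R² ≤ −t` (the content is `R ≫ √(−t)`) -/

/-- Pointwise Type-I bound integrated: `∫_{B_R(x₀)} |u(t)|² ≤ C²/(−t) · R³ V₁`. -/
theorem setIntegral_ball_le_typeI {C : ℝ} {u : ℝ → ℝ³ → ℝ³} (h : IsTypeIAncientMild C u) {t : ℝ}
    (ht : t < 0) (x₀ : ℝ³) {R : ℝ} (hR : 0 < R) :
    ∫ x in ball x₀ R, ‖u t x‖ ^ 2 ≤ C ^ 2 / (-t) * (R ^ 3 * V1) := by
  have hpt : ∀ x, ‖u t x‖ ^ 2 ≤ C ^ 2 / (-t) := fun x => by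
    have h1 := h.norm_le ht x
    have h2 : (C / Real.sqrt (-t)) ^ 2 = C ^ 2 / (-t) := by
      rw [div_pow, Real.sq_sqrt (by linarith)]
    rw [← h2]
    exact pow_le_pow_left₀ (norm_nonneg _) h1 2
  calc ∫ x in ball x₀ R, ‖u t x‖ ^ 2 ≤ ∫ _x in ball x₀ R, C ^ 2 / (-t) :=
        integral_mono_of_nonneg (Eventually.of_forall fun x => by positivity)
          (integrableOn_const measure_ball_lt_top.ne) (Eventually.of_forall hpt)
    _ = C ^ 2 / (-t) * (R ^ 3 * V1) := setIntegral_ball_const x₀ hR _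

/-- **The ledger holds at the Leray rate inside the parabolic interior** `R² ≤ −t`, with
`K = C² V₁`, from the Type-I bound alone. -/
theorem ledger_parabolic_interior {C : ℝ} {u : ℝ → ℝ³ → ℝ³} (h : IsTypeIAncientMild C u) {t : ℝ}
    (ht : t < 0) (x₀ : ℝ³) {R : ℝ} (hR : 0 < R) (hRt : R ^ 2 ≤ -t) :
    ∫ x in ball x₀ R, ‖u t x‖ ^ 2 ≤ (C ^ 2 * V1) * R := by
  refine (setIntegral_ball_le_typeI h ht x₀ hR).trans ?_
  have ht' : 0 < -t := by linarith
  have hq : R ^ 2 / (-t) ≤ 1 := (div_le_one ht').2 hRt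
  have hnn : 0 ≤ C ^ 2 * V1 * R := by have := V1_nonneg; positivity
  calc C ^ 2 / (-t) * (R ^ 3 * V1) = C ^ 2 * V1 * R * (R ^ 2 / (-t)) := by
        field_simp
    _ ≤ C ^ 2 * V1 * R * 1 := by gcongr
    _ = C ^ 2 * V1 * R := mul_one _

/-! ## §5 LOAD-BEARING HYPOTHESES (any proof must use them) -/

/-- `‖e₀‖ = 1`. -/
theorem norm_e0 : ‖(e0 : ℝ³)‖ = 1 := by simp [e0]

/-! ### §5a The Oseen/KNSS mild clause (3): parasitic `b(t) = (1−t)⁻¹ e₀` -/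

/-- The parasitic field `par t x = (1 − t)⁻¹ e₀` (KNSS 2009 §1 p. 3: `u = b(t)`, `p = −b'(t)·x`
solves NS classically but is not mild). -/
def par : ℝ → ℝ³ → ℝ³ := fun t _ => (1 - t)⁻¹ • e0

/-- `par` is smooth on the open slab `t < 0`. -/
theorem par_smooth : ContDiffOn ℝ (⊤ : ℕ∞) (Function.uncurry par) (Iio 0 ×ˢ univ) := by
  have e : Function.uncurry par = fun p : ℝ × ℝ³ => (1 - p.1)⁻¹ • (e0 : ℝ³) := rfl
  rw [e]
  refine ContDiffOn.smul ((contDiffOn_const.sub contDiffOn_fst).inv fun p hp => ?_) contDiffOn_const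
  have : p.1 < 0 := hp.1
  exact ne_of_gt (by linarith)

/-- `par` has divergence-free (constant) slices. -/
theorem par_divFree (t : ℝ) : VectorCalculus.IsDivFree (par t) := fun x => by
  rw [show par t = fun _ => (1 - t)⁻¹ • (e0 : ℝ³) from rfl]
  simp [VectorCalculus.divergence]

/-- `par` obeys the Type-I rate with `C = 1`: `(1−t)⁻¹ ≤ 1/√(−t)`. -/
theorem par_typeI : HasTypeITimeDecay 1 par := by
  intro t ht x
  have h1 : 0 < 1 - t := by linarith
  have hs : 0 < Real.sqrt (-t) := Real.sqrt_pos.2 (by linarith)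
  have hsq : Real.sqrt (-t) ≤ 1 - t := Real.sqrt_le_iff.2 ⟨h1.le, by nlinarith⟩
  simp only [par, norm_smul, norm_inv, Real.norm_of_nonneg h1.le, norm_e0, mul_one, one_div]
  exact inv_anti₀ hs hsq

/-- At `t = −1` the parasitic field has energy `R³V₁/4` in `B_R`, beating `K·R` for large `R`. -/
theorem par_energy_gt (K : ℝ) : ∃ R, 0 < R ∧ K * R < ∫ x in ball (0 : ℝ³) R, ‖par (-1) x‖ ^ 2 := by
  have hV := V1_pos
  set R : ℝ := 4 * |K| / V1 + 1 with hR
  have hRpos : 0 < R := by positivity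
  have hR1 : 1 ≤ R := by
    have : 0 ≤ 4 * |K| / V1 := by positivity
    linarith
  have hRV : R * V1 = 4 * |K| + V1 := by rw [hR, add_mul, one_mul, div_mul_cancel₀ _ hV.ne']
  refine ⟨R, hRpos, ?_⟩
  have hval : ∀ x, ‖par (-1) x‖ ^ 2 = 1 / 4 := fun x => by
    simp only [par, norm_smul, norm_inv, norm_e0, mul_one]; norm_num
  simp only [hval]
  rw [setIntegral_ball_const 0 hRpos]
  have hnn : 0 ≤ R * V1 / 4 * R := by have := hRpos.le; have := hV.le; positivity
  calc K * R ≤ |K| * R := by gcongr; exact le_abs_self K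
    _ < (R * V1 / 4) * R := by apply mul_lt_mul_of_pos_right _ hRpos; linarith
    _ ≤ (R * V1 / 4) * R * R := le_mul_of_one_le_right hnn hR1
    _ = 1 / 4 * (R ^ 3 * V1) := by ring

/-- `A_C` with the Oseen/KNSS mild clause (3) DELETED (smooth ∧ div-free ∧ Type-I only). -/
def IsTypeIAncientNoGauge (C : ℝ) (u : ℝ → ℝ³ → ℝ³) : Prop :=
  ContDiffOn ℝ (⊤ : ℕ∞) (Function.uncurry u) (Iio 0 ×ˢ univ) ∧ (∀ t < 0, VectorCalculus.IsDivFree (u t)) ∧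
    HasTypeITimeDecay C u

/-- The crux with clause (3) deleted. -/
def FarPastLedgerWithoutMild : Prop :=
  ∀ C : ℝ, ∃ K : ℝ, ∀ (u : ℝ → ℝ³ → ℝ³), IsTypeIAncientNoGauge C u → ∀ t < 0, ∀ (x₀ : ℝ³) (R : ℝ), 0 < R →
    ∫ x in ball x₀ R, ‖u t x‖ ^ 2 ≤ K * R

/-- **Clause (3) is load-bearing**: without the Oseen/KNSS gauge the ledger is FALSE (at `C = 1`),
by the parasitic `par` (energy `∝ R³/(−t)`).  So any proof must use the integral equation, i.e.
the PDE and its gauge — as the card says. -/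
theorem farPastLedger_false_without_mild : ¬ FarPastLedgerWithoutMild := by
  intro h
  obtain ⟨K, hK⟩ := h 1
  obtain ⟨R, hR, hlt⟩ := par_energy_gt K
  exact absurd (hK par ⟨par_smooth, fun t _ => par_divFree t, par_typeI⟩ (-1) (by norm_num) 0 R hR)
    (not_le.2 hlt)

/-! ### §5b The Type-I clause (4) and ancientness: constants -/

/-- The constant field `e₀`. -/
def cst : ℝ → ℝ³ → ℝ³ := fun _ _ => e0

/-- Constants are smooth on any set. -/
theorem cst_smooth (S : Set (ℝ × ℝ³)) : ContDiffOn ℝ (⊤ : ℕ∞) (Function.uncurry cst) S :=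
  contDiffOn_const

/-- Constants are divergence free. -/
theorem cst_divFree (t : ℝ) : VectorCalculus.IsDivFree (cst t) := fun x => by
  rw [show cst t = fun _ => (e0 : ℝ³) from rfl]
  simp [VectorCalculus.divergence]

/-- Constants are KNSS-mild between any two times (`e^{σΔ}c = c`, `B(c,c) = 0`: KNSS Rem. 6.1). -/
theorem cst_mild {s t : ℝ} (hst : s < t) (x : ℝ³) :
    cst t x = heatFlow (cst s) (t - s) x - oseenDuhamel 1 s cst cst t x := by
  rw [oseenDuhamel_eq_zero_of_const (u := cst) (v := cst) (b := fun _ => e0) (c := fun _ => e0)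
    (fun τ _ y => rfl) (fun τ _ y => rfl), heatFlow_of_pos _ (sub_pos.2 hst), sub_zero]
  show e0 = heatExtension (fun _ : ℝ³ => e0) (t - s) x
  rw [heatExtension_const _ (sub_pos.2 hst)]

/-- `‖cst t x‖ = 1`. -/
theorem norm_cst (t : ℝ) (x : ℝ³) : ‖cst t x‖ = 1 := norm_e0

/-- Constants have energy `R³V₁` in `B_R`, beating `K·R` for large `R`. -/
theorem cst_energy_gt (K t : ℝ) : ∃ R, 0 < R ∧ K * R < ∫ x in ball (0 : ℝ³) R, ‖cst t x‖ ^ 2 := by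
  have hV := V1_pos
  set R : ℝ := |K| / V1 + 1 with hR
  have hRpos : 0 < R := by positivity
  have hR1 : 1 ≤ R := by
    have : 0 ≤ |K| / V1 := by positivity
    linarith
  have hRV : R * V1 = |K| + V1 := by rw [hR, add_mul, one_mul, div_mul_cancel₀ _ hV.ne']
  refine ⟨R, hRpos, ?_⟩
  have hval : ∀ x, ‖cst t x‖ ^ 2 = 1 := fun x => by rw [norm_cst, one_pow]
  simp only [hval]
  rw [setIntegral_ball_const 0 hRpos, one_mul]
  have hnn : 0 ≤ R * V1 * R := by have := hRpos.le; have := hV.le; positivity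
  calc K * R ≤ |K| * R := by gcongr; exact le_abs_self K
    _ < (R * V1) * R := by apply mul_lt_mul_of_pos_right _ hRpos; linarith
    _ ≤ (R * V1) * R * R := le_mul_of_one_le_right hnn hR1
    _ = R ^ 3 * V1 := by ring

/-- Clause (4) replaced by mere boundedness `‖u‖ ≤ M`: KNSS's bounded ancient mild class (smooth,
div-free, Oseen-mild between all `s < t < 0`, bounded). -/
def IsBoundedAncientMildField (M : ℝ) (u : ℝ → ℝ³ → ℝ³) : Prop :=
  ContDiffOn ℝ (⊤ : ℕ∞) (Function.uncurry u) (Iio 0 ×ˢ univ) ∧ (∀ t < 0, VectorCalculus.IsDivFree (u t)) ∧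
    (∀ s t : ℝ, s < t → t < 0 → ∀ x, u t x = heatFlow (u s) (t - s) x - oseenDuhamel 1 s u u t x) ∧
    ∀ t < 0, ∀ x, ‖u t x‖ ≤ M

/-- The crux with the Type-I rate weakened to boundedness. -/
def FarPastLedgerWithoutTypeI : Prop :=
  ∀ M : ℝ, ∃ K : ℝ, ∀ (u : ℝ → ℝ³ → ℝ³), IsBoundedAncientMildField M u → ∀ t < 0, ∀ (x₀ : ℝ³) (R : ℝ),
    0 < R → ∫ x in ball x₀ R, ‖u t x‖ ^ 2 ≤ K * R

/-- **Clause (4) is load-bearing**: in the bounded ancient mild class the ledger is FALSE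
(constants; energy `R³V₁`).  A proof must use the Type-I DECAY at `t → −∞`, not only mildness.
(Weakening (4) to `‖u(t)‖_∞ → 0` without rate is not cheaply refutable: no nonconstant bounded
ancient mild solution of 3-D NS is known — KNSS Liouville conjecture.) -/
theorem farPastLedger_false_without_typeI : ¬ FarPastLedgerWithoutTypeI := by
  intro h
  obtain ⟨K, hK⟩ := h 1
  obtain ⟨R, hR, hlt⟩ := cst_energy_gt K (-1)
  refine absurd (hK cst ⟨cst_smooth _, fun t _ => cst_divFree t, fun s t hst _ x => cst_mild hst x,
    fun t _ x => (norm_cst t x).le⟩ (-1) (by norm_num) 0 R hR) (not_le.2 hlt)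

/-- The class on the FINAL UNIT WINDOW `(−1, 0)` only (ancientness deleted; everything else kept,
including the Type-I rate on the window). -/
def IsTypeIMildOnUnitWindow (C : ℝ) (u : ℝ → ℝ³ → ℝ³) : Prop :=
  ContDiffOn ℝ (⊤ : ℕ∞) (Function.uncurry u) (Ioo (-1) 0 ×ˢ univ) ∧
    (∀ t ∈ Ioo (-1 : ℝ) 0, VectorCalculus.IsDivFree (u t)) ∧
    (∀ s t : ℝ, -1 < s → s < t → t < 0 → ∀ x, u t x = heatFlow (u s) (t - s) x - oseenDuhamel 1 s u u t x) ∧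
    ∀ t ∈ Ioo (-1 : ℝ) 0, ∀ x, ‖u t x‖ ≤ C / Real.sqrt (-t)

/-- The crux on the final unit window. -/
def FarPastLedgerOnUnitWindow : Prop :=
  ∀ C : ℝ, ∃ K : ℝ, ∀ (u : ℝ → ℝ³ → ℝ³), IsTypeIMildOnUnitWindow C u → ∀ t ∈ Ioo (-1 : ℝ) 0,
    ∀ (x₀ : ℝ³) (R : ℝ), 0 < R → ∫ x in ball x₀ R, ‖u t x‖ ^ 2 ≤ K * R

/-- **Ancientness (the FAR PAST) is load-bearing**: on a final window the ledger is FALSE at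
`C = 1` (constants `e₀` obey `1 ≤ 1/√(−t)` on `(−1,0)`).  This is exactly AlbrittonBarker2019
Rem. 3.2's setting (solutions on `(−1,0)`): there the Type-I rate does not give `𝐈 < ∞`; the crux's
bet is the entry time `−4R²`, which only ancient solutions have. -/
theorem farPastLedger_false_on_window : ¬ FarPastLedgerOnUnitWindow := by
  intro h
  obtain ⟨K, hK⟩ := h 1
  obtain ⟨R, hR, hlt⟩ := cst_energy_gt K (-1 / 2)
  have hmem : IsTypeIMildOnUnitWindow 1 cst := by
    refine ⟨cst_smooth _, fun t _ => cst_divFree t, fun s t _ hst _ x => cst_mild hst x, fun t ht x => ?_⟩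
    have hs : 0 < Real.sqrt (-t) := Real.sqrt_pos.2 (by linarith [ht.2])
    rw [norm_cst, le_div_iff₀ hs, one_mul]
    calc Real.sqrt (-t) ≤ Real.sqrt 1 := Real.sqrt_le_sqrt (by linarith [ht.1])
      _ = 1 := Real.sqrt_one
  exact absurd (hK cst hmem (-1 / 2) ⟨by norm_num, by norm_num⟩ 0 R hR) (not_le.2 hlt)

/-! ## §6 EXACT SCALE INVARIANCE of the class and of the ledger; reductions; exponent rigidity -/

/-- `u_c(t,x) = c u(c²t, cx)` is the zoom `c • stPull c² c 0 0 u` of `KNSSTypeIRateMildProofs`. -/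
theorem nsRescale_eq_smul_stPull (c : ℝ) (u : ℝ → ℝ³ → ℝ³) :
    nsRescale c u = c • stPull (c ^ 2) c 0 0 u := by
  funext s y
  simp only [nsRescale_apply, Pi.smul_apply, stPull_apply, zero_add]

/-- **`A_C` is invariant under the parabolic scaling** `u ↦ c u(c²t, cx)`, `c > 0` (same `C`):
smoothness and divergence-freeness transport along the linear substitution, the Oseen equation by
`oseen_smul_stPull` (homogeneity of the Oseen kernel), the rate by `HasTypeITimeDecay.nsRescale`. -/
theorem isTypeIAncientMild_nsRescale {C : ℝ} {u : ℝ → ℝ³ → ℝ³} (h : IsTypeIAncientMild C u) {c : ℝ}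
    (hc : 0 < c) : IsTypeIAncientMild C (nsRescale c u) := by
  have hc2 : 0 < c ^ 2 := pow_pos hc 2
  refine ⟨?_, fun t ht => ?_, fun s t hst ht x => ?_, h.hasTypeITimeDecay.nsRescale hc⟩
  · have e : Function.uncurry (nsRescale c u) =
        fun p : ℝ × ℝ³ => c • Function.uncurry u (c ^ 2 * p.1, c • p.2) := by
      funext p; rfl
    rw [e]
    refine (h.contDiffOn.comp
      ((contDiff_const.mul contDiff_fst).prodMk (contDiff_snd.const_smul c)).contDiffOn
      fun p hp => ?_).const_smul c
    have hp1 : p.1 < 0 := hp.1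
    exact mk_mem_prod (mul_neg_of_pos_of_neg hc2 hp1) (mem_univ _)
  · have hct : c ^ 2 * t < 0 := mul_neg_of_pos_of_neg hc2 ht
    have hd : VectorCalculus.IsDivFree (fun x : ℝ³ => u (c ^ 2 * t) (c • x)) :=
      (h.isDivFree hct).comp_smul c
    have hdiff : Differentiable ℝ (fun x : ℝ³ => u (c ^ 2 * t) (c • x)) :=
      ((h.contDiff_slice hct).differentiable (by simp)).comp (differentiable_id.const_smul c)
    intro x
    have e : nsRescale c u t = fun y => c • (fun z : ℝ³ => u (c ^ 2 * t) (c • z)) y := rfl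
    rw [e]
    simp only [VectorCalculus.divergence, fderiv_fun_const_smul (hdiff x) c,
      ContinuousLinearMap.toLinearMap_smul, map_smul, smul_eq_mul]
    have key := hd x
    simp only [VectorCalculus.divergence] at key
    rw [key, mul_zero]
  · have hst' : (0 : ℝ) + c ^ 2 * s < 0 + c ^ 2 * t := by nlinarith
    have ht' : (0 : ℝ) + c ^ 2 * t < 0 := by nlinarith
    have hu : ∀ X, u (0 + c ^ 2 * t) X = heatExtension (u (0 + c ^ 2 * s)) (0 + c ^ 2 * t - (0 + c ^ 2 * s)) X -
        oseenDuhamel 1 (0 + c ^ 2 * s) u u (0 + c ^ 2 * t) X :=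
      fun X => h.mild_eq_heatExtension hst' ht' X
    have key := oseen_smul_stPull hc 0 (0 : ℝ³) hst hu x
    rw [nsRescale_eq_smul_stPull, heatFlow_of_pos _ (sub_pos.2 hst)]
    exact key

/-- **Scaling law of the local energy**: `∫_{B_R(x₀)} |u_c(t)|² = c⁻¹ ∫_{B_{cR}(cx₀)} |u(c²t)|²`;
with `R ↦ K·R` this makes the ledger EXACTLY scale invariant. -/
theorem setIntegral_ball_nsRescale {c : ℝ} (hc : 0 < c) (u : ℝ → ℝ³ → ℝ³) (t : ℝ) (x₀ : ℝ³) (R : ℝ) :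
    ∫ x in ball x₀ R, ‖nsRescale c u t x‖ ^ 2 = c⁻¹ * ∫ y in ball (c • x₀) (c * R), ‖u (c ^ 2 * t) y‖ ^ 2 := by
  have e : ∀ x, ‖nsRescale c u t x‖ ^ 2 = c ^ 2 * (fun y => ‖u (c ^ 2 * t) y‖ ^ 2) (c • x) := fun x => by
    simp only [nsRescale_apply, norm_smul, Real.norm_of_nonneg hc.le, mul_pow]
  simp_rw [e]
  rw [integral_const_mul, Measure.setIntegral_comp_smul_of_pos volume (fun y => ‖u (c ^ 2 * t) y‖ ^ 2)
    (ball x₀ R) hc, smul_ball hc.ne' x₀ R, Real.norm_of_nonneg hc.le, finrank_euclideanSpace_fin, smul_eq_mul]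
  field_simp

/-- ONE-SLICE FORM of the ledger: the time `t = −1` only. -/
def LedgerAtNegOne : Prop :=
  ∀ C : ℝ, ∃ K : ℝ, ∀ (u : ℝ → ℝ³ → ℝ³), IsTypeIAncientMild C u → ∀ (x₀ : ℝ³) (R : ℝ), 0 < R →
    ∫ x in ball x₀ R, ‖u (-1) x‖ ^ 2 ≤ K * R

/-- **Reduction to one time slice** (scaling `c = √(−t)`): the crux is equivalent to its `t = −1`
instance, uniformly over `A_C`. -/
theorem farPastLedgerSig_iff_atNegOne : FarPastLedgerSig ↔ LedgerAtNegOne := by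
  constructor
  · intro h C
    obtain ⟨K, hK⟩ := h C
    exact ⟨K, fun u hu x₀ R hR => hK u hu (-1) (by norm_num) x₀ R hR⟩
  · intro h C
    obtain ⟨K, hK⟩ := h C
    refine ⟨K, fun u hu t ht x₀ R hR => ?_⟩
    have hl : 0 < Real.sqrt (-t) := Real.sqrt_pos.2 (by linarith)
    set l := Real.sqrt (-t) with hl_def
    have hl2 : l ^ 2 * (-1) = t := by rw [hl_def, Real.sq_sqrt (by linarith)]; ring
    have key := hK (nsRescale l u) (isTypeIAncientMild_nsRescale hu hl) (l⁻¹ • x₀) (l⁻¹ * R) (by positivity)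
    rw [setIntegral_ball_nsRescale hl, smul_smul, mul_inv_cancel₀ hl.ne', one_smul, ← mul_assoc,
      mul_inv_cancel₀ hl.ne', one_mul, hl2] at key
    have key' : l⁻¹ * (∫ x in ball x₀ R, ‖u t x‖ ^ 2) ≤ l⁻¹ * (K * R) :=
      key.trans_eq (by ring)
    exact le_of_mul_le_mul_left key' (inv_pos.2 hl)

/-- UNIT-BALL FORM: all times, all centres, radius `1`, bound `K` (no `R`). -/
def LedgerUnitBalls : Prop :=
  ∀ C : ℝ, ∃ K : ℝ, ∀ (u : ℝ → ℝ³ → ℝ³), IsTypeIAncientMild C u → ∀ t < 0, ∀ (x₀ : ℝ³),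
    ∫ x in ball x₀ 1, ‖u t x‖ ^ 2 ≤ K

/-- **Reduction to unit balls** (scaling `c = R`): the crux says exactly that the energy in unit
balls is bounded over `A_C` UNIFORMLY IN TIME `t ∈ (−∞, 0)` — trivially so for `t ≤ −1`
(`ledger_parabolic_interior`); the content is NO CONCENTRATION OF LOCAL ENERGY AS `t → 0⁻`
(Albritton–Barker's `A(1) = sup_t ∫_{B₁}|u|² < ∞`, i.e. `u ∈ L^∞_t Ṁ^{2,1}_x = L^∞_t (Morrey
space with the scaling of L³)` uniformly over the class). -/
theorem farPastLedgerSig_iff_unitBalls : FarPastLedgerSig ↔ LedgerUnitBalls := by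
  constructor
  · intro h C
    obtain ⟨K, hK⟩ := h C
    exact ⟨K * 1, fun u hu t ht x₀ => hK u hu t ht x₀ 1 one_pos⟩
  · intro h C
    obtain ⟨K, hK⟩ := h C
    refine ⟨K, fun u hu t ht x₀ R hR => ?_⟩
    have htR : t / R ^ 2 < 0 := div_neg_of_neg_of_pos ht (pow_pos hR 2)
    have key := hK (nsRescale R u) (isTypeIAncientMild_nsRescale hu hR) (t / R ^ 2) htR (R⁻¹ • x₀)
    have e2 : R ^ 2 * (t / R ^ 2) = t := by field_simp
    rw [setIntegral_ball_nsRescale hR, smul_smul, mul_inv_cancel₀ hR.ne', one_smul, mul_one, e2] at key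
    have key' : R⁻¹ * (∫ x in ball x₀ R, ‖u t x‖ ^ 2) ≤ R⁻¹ * (K * R) :=
      key.trans_eq (by field_simp)
    exact le_of_mul_le_mul_left key' (inv_pos.2 hR)

/-- The spatial translate `u(t, x₀ + ·)` is the zoom `1 • stPull 1 1 0 x₀ u`. -/
theorem translate_eq_smul_stPull (x₀ : ℝ³) (u : ℝ → ℝ³ → ℝ³) :
    (fun t x => u t (x₀ + x)) = (1 : ℝ) • stPull ((1 : ℝ) ^ 2) 1 0 x₀ u := by
  funext s y
  simp only [Pi.smul_apply, stPull_apply, one_pow, one_mul, zero_add, one_smul]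

/-- **`A_C` is invariant under spatial translations** (same `C`). -/
theorem isTypeIAncientMild_translate {C : ℝ} {u : ℝ → ℝ³ → ℝ³} (h : IsTypeIAncientMild C u) (x₀ : ℝ³) :
    IsTypeIAncientMild C (fun t x => u t (x₀ + x)) := by
  refine ⟨?_, fun t ht => ?_, fun s t hst ht x => ?_, fun t ht x => h.norm_le ht _⟩
  · have e : Function.uncurry (fun t x => u t (x₀ + x)) =
        fun p : ℝ × ℝ³ => Function.uncurry u (p.1, x₀ + p.2) := by
      funext p; rfl
    rw [e]
    exact h.contDiffOn.comp (contDiff_fst.prodMk (contDiff_const.add contDiff_snd)).contDiffOn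
      fun p hp => mk_mem_prod hp.1 (mem_univ _)
  · intro x
    have key := h.isDivFree ht (x₀ + x)
    simp only [VectorCalculus.divergence] at key ⊢
    rw [fderiv_comp_add_left]
    exact key
  · have hu : ∀ X, u (0 + (1 : ℝ) ^ 2 * t) X =
        heatExtension (u (0 + (1 : ℝ) ^ 2 * s)) (0 + (1 : ℝ) ^ 2 * t - (0 + (1 : ℝ) ^ 2 * s)) X -
          oseenDuhamel 1 (0 + (1 : ℝ) ^ 2 * s) u u (0 + (1 : ℝ) ^ 2 * t) X := by
      intro X
      simpa using h.mild_eq_heatExtension hst ht X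
    have key := oseen_smul_stPull one_pos 0 x₀ hst hu x
    rw [translate_eq_smul_stPull, heatFlow_of_pos _ (sub_pos.2 hst)]
    exact key

/-- Translation of the local energy: `∫_{B_R(0)} |u(t, x₀ + y)|² dy = ∫_{B_R(x₀)} |u(t)|²`. -/
theorem setIntegral_ball_translate (u : ℝ → ℝ³ → ℝ³) (t : ℝ) (x₀ : ℝ³) (R : ℝ) :
    ∫ y in ball (0 : ℝ³) R, ‖u t (x₀ + y)‖ ^ 2 = ∫ y in ball x₀ R, ‖u t y‖ ^ 2 := by
  rw [← integral_indicator measurableSet_ball, ← integral_indicator measurableSet_ball]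
  have e : (ball (0 : ℝ³) R).indicator (fun y => ‖u t (x₀ + y)‖ ^ 2) =
      fun y => (ball x₀ R).indicator (fun y => ‖u t y‖ ^ 2) (x₀ + y) := by
    funext y
    by_cases hy : y ∈ ball (0 : ℝ³) R
    · have hy' : x₀ + y ∈ ball x₀ R := by simpa [mem_ball, dist_eq_norm] using hy
      simp [Set.indicator, hy, hy']
    · have hy' : x₀ + y ∉ ball x₀ R := by simpa [mem_ball, dist_eq_norm] using hy
      simp [Set.indicator, hy, hy']
  rw [e, integral_add_left_eq_self]

/-- UNIT BALL AT THE ORIGIN, all times: the sharpest target form of the crux. -/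
def LedgerUnitBall : Prop :=
  ∀ C : ℝ, ∃ K : ℝ, ∀ (u : ℝ → ℝ³ → ℝ³), IsTypeIAncientMild C u → ∀ t < 0,
    ∫ x in ball (0 : ℝ³) 1, ‖u t x‖ ^ 2 ≤ K

/-- **crux ⇔ `sup_{u ∈ A_C} sup_{t < 0} ∫_{B₁(0)} |u(t)|² < ∞`** (scaling + translation). -/
theorem farPastLedgerSig_iff_unitBall : FarPastLedgerSig ↔ LedgerUnitBall := by
  rw [farPastLedgerSig_iff_unitBalls]
  constructor
  · intro h C
    obtain ⟨K, hK⟩ := h C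
    exact ⟨K, fun u hu t ht => hK u hu t ht 0⟩
  · intro h C
    obtain ⟨K, hK⟩ := h C
    refine ⟨K, fun u hu t ht x₀ => ?_⟩
    have key := hK _ (isTypeIAncientMild_translate hu x₀) t ht
    rwa [setIntegral_ball_translate u t x₀ 1] at key

/-- FINAL-WINDOW FORM: unit ball at the origin, times `t ∈ (−1, 0)` only. -/
def LedgerUnitBallNearZero : Prop :=
  ∀ C : ℝ, ∃ K : ℝ, ∀ (u : ℝ → ℝ³ → ℝ³), IsTypeIAncientMild C u → ∀ t ∈ Ioo (-1 : ℝ) 0,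
    ∫ x in ball (0 : ℝ³) 1, ‖u t x‖ ^ 2 ≤ K

/-- **The whole content of the crux sits on the final unit window of ANCIENT elements**:
crux ⇔ `sup_{u ∈ A_C} sup_{−1 < t < 0} ∫_{B₁(0)}|u(t)|² < ∞` (for `t ≤ −1` the unit ball is inside the
parabolic interior, `setIntegral_ball_le_typeI`).  Contrast `farPastLedger_false_on_window`
(`Negative/LoadBearing`): the same window statement for the NON-ancient Type-I mild class is false. -/
theorem farPastLedgerSig_iff_unitBallNearZero : FarPastLedgerSig ↔ LedgerUnitBallNearZero := by
  rw [farPastLedgerSig_iff_unitBall]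
  constructor
  · intro h C
    obtain ⟨K, hK⟩ := h C
    exact ⟨K, fun u hu t ht => hK u hu t ht.2⟩
  · intro h C
    obtain ⟨K, hK⟩ := h C
    refine ⟨max K (C ^ 2 * (ENNReal.toReal (volume (ball (0 : ℝ³) 1)))), fun u hu t ht => ?_⟩
    rcases lt_or_ge (-1 : ℝ) t with h1 | h1
    · exact (hK u hu t ⟨h1, ht⟩).trans (le_max_left _ _)
    · refine le_trans ?_ (le_max_right _ _)
      have hpt : ∀ x, ‖u t x‖ ^ 2 ≤ C ^ 2 := fun x => by
        have h1' := hu.norm_le ht x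
        have hs1 : 1 ≤ Real.sqrt (-t) := by
          rw [← Real.sqrt_one]; exact Real.sqrt_le_sqrt (by linarith)
        have h2 : C / Real.sqrt (-t) ≤ C := div_le_self hu.nonneg hs1
        have h3 : ‖u t x‖ ≤ C := h1'.trans h2
        exact pow_le_pow_left₀ (norm_nonneg _) h3 2
      calc ∫ x in ball (0 : ℝ³) 1, ‖u t x‖ ^ 2 ≤ ∫ _x in ball (0 : ℝ³) 1, C ^ 2 :=
            integral_mono_of_nonneg (Eventually.of_forall fun x => by positivity)
              (integrableOn_const measure_ball_lt_top.ne) (Eventually.of_forall hpt)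
        _ = C ^ 2 * (volume (ball (0 : ℝ³) 1)).toReal := by
            rw [setIntegral_const, smul_eq_mul, measureReal_def, mul_comm]

/-- The ledger with a general exponent `a`: `∫_{B_R(x₀)} |u(t)|² ≤ K R^a`. -/
def FarPastLedgerExp (a : ℝ) : Prop :=
  ∀ C : ℝ, ∃ K : ℝ, ∀ (u : ℝ → ℝ³ → ℝ³), IsTypeIAncientMild C u → ∀ t < 0, ∀ (x₀ : ℝ³) (R : ℝ), 0 < R →
    ∫ x in ball x₀ R, ‖u t x‖ ^ 2 ≤ K * R ^ a

/-- `a = 1` is the crux. -/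
theorem farPastLedgerExp_one_iff : FarPastLedgerExp 1 ↔ FarPastLedgerSig := by
  simp only [FarPastLedgerExp, FarPastLedgerSig, Real.rpow_one]

/-- **EXPONENT RIGIDITY.** For every exponent `a ≠ 1` the uniform ledger `∫_{B_R}|u(t)|² ≤ K(C) R^a`
FORCES `A_C = {0}`, i.e. it is the Liouville theorem X itself: scaling a putative element by `c`
improves the constant to `K c^{1−a}`, and `c → 0` (`a < 1`) or `c → ∞` (`a > 1`) kills the unit-ball
energy.  So the Leray exponent `a = 1` is the ONLY member of the family with content short of X:
the natural strengthening `a < 1` is X in costume, and so is the seemingly weaker `a > 1` (e.g. the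
volume rate `a = 3` uniformly in `t`). -/
theorem classLiouville_of_farPastLedgerExp {a : ℝ} (ha : a ≠ 1) (h : FarPastLedgerExp a) :
    ClassLiouville := by
  intro C u hu t ht x
  obtain ⟨K, hK⟩ := h C
  set I := ∫ y in ball x 1, ‖u t y‖ ^ 2 with hI
  -- Step 1: `I ≤ K c^{1-a}` for every `c > 0`
  have hIc : ∀ c : ℝ, 0 < c → I ≤ K * c ^ (1 - a) := by
    intro c hc
    have hct : t / c ^ 2 < 0 := div_neg_of_neg_of_pos ht (pow_pos hc 2)
    have key := hK (nsRescale c u) (isTypeIAncientMild_nsRescale hu hc) (t / c ^ 2) hct (c⁻¹ • x) c⁻¹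
      (inv_pos.2 hc)
    have e2 : c ^ 2 * (t / c ^ 2) = t := by field_simp
    rw [setIntegral_ball_nsRescale hc, smul_smul, mul_inv_cancel₀ hc.ne', one_smul, e2] at key
    have hca : 0 < c ^ a := Real.rpow_pos_of_pos hc a
    have e : K * c⁻¹ ^ a = c⁻¹ * (K * c ^ (1 - a)) := by
      rw [Real.inv_rpow hc.le, Real.rpow_sub hc, Real.rpow_one]
      field_simp
    rw [e] at key
    exact le_of_mul_le_mul_left key (inv_pos.2 hc)
  -- Step 2: hence `I ≤ 0`
  have hI0 : I ≤ 0 := by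
    by_contra hpos
    push Not at hpos
    rcases le_or_gt K 0 with hK0 | hK0
    · have h1 := hIc 1 one_pos
      rw [Real.one_rpow, mul_one] at h1
      linarith
    · have h1a : 1 - a ≠ 0 := sub_ne_zero.2 (Ne.symm ha)
      have hq0 : 0 < I / (2 * K) := by positivity
      have h2 := hIc ((I / (2 * K)) ^ (1 / (1 - a))) (Real.rpow_pos_of_pos hq0 _)
      rw [← Real.rpow_mul hq0.le, one_div, inv_mul_cancel₀ h1a, Real.rpow_one] at h2
      have h3 : K * (I / (2 * K)) = I / 2 := by field_simp
      linarith
  -- Step 3: `I = 0` and continuity force `u t x = 0`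
  by_contra hx
  have hcont : Continuous fun y => ‖u t y‖ ^ 2 := ((hu.continuous_slice ht).norm).pow 2
  have hfx : 0 < ‖u t x‖ ^ 2 := pow_pos (norm_pos_iff.2 hx) 2
  have hIpos : 0 < I := by
    rw [hI, setIntegral_pos_iff_support_of_nonneg_ae (Eventually.of_forall fun y => by positivity)
      ((hcont.continuousOn.integrableOn_compact (isCompact_closedBall x 1)).mono_set ball_subset_closedBall)]
    refine (IsOpen.inter (isOpen_ne_fun hcont continuous_const) isOpen_ball).measure_pos volume
      ⟨x, ?_, mem_ball_self one_pos⟩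
    exact hfx.ne'
  linarith

/-- The rigidity as an equivalence: for `a ≠ 1`, `FarPastLedgerExp a ↔ X` (over the class). -/
theorem farPastLedgerExp_iff_classLiouville {a : ℝ} (ha : a ≠ 1) : FarPastLedgerExp a ↔ ClassLiouville := by
  refine ⟨classLiouville_of_farPastLedgerExp ha, fun hL C => ⟨0, fun u hu t ht x₀ R _ => ?_⟩⟩
  have h0 : ∀ x, ‖u t x‖ ^ 2 = 0 := fun x => by rw [hL C u hu t ht x, norm_zero]; ring
  simp only [h0, integral_zero, zero_mul, le_refl]

/-! ## §7 Paper audit of the card's bootstrap (no Lean content) -/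

/-- PAPER AUDIT (informal; recorded for the provers).

WHAT THE LITERATURE SAYS. AlbrittonBarker2019 (arXiv:1811.00502) Thm 3.1 p. 7: for `3 ≤ p < ∞`,
"∃ suitable weak solution in `Q` singular at 0 with `esssup_{−1<t<0} (−t)^{1/2−3/2p}‖v‖_{L^{p,∞}(B)} < ∞`"
⇔ "∃ mild bounded ANCIENT solution with `esssup_{t<0} (−t)^{1/2−3/2p}‖v‖_{L^{p,∞}} < ∞`"; Rem. 3.2
(verbatim, p. 7): "`p = ∞` is omitted … because `sup_{t<0} √(−t)‖v(·,t)‖_{L^∞} < ∞` alone does not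
appear to guarantee `𝐈 < ∞`, or even that the local energy is finite up to (and including) the blow-up
time.  This is related to the fact that no global-in-time weak solution theory is known for `L^∞`
initial data."  By `farPastLedgerSig_iff_unitBall` the crux is EXACTLY the second clause ("local energy
finite up to the blow-up time", uniformly over `A_C`) for ancient elements — so the crux asserts what AB
flag as unclear (for ancient solutions too: their second bullet is ancient), not something they disprove.
Their obstruction is the FORWARD viewpoint (restart from `v(−1) ∈ L^∞ ⊂ L²_uloc`: local-energy theory
controls `‖v(t)‖_{L²_uloc}` only for a short time `∼ (1 + C⁴)⁻¹`, and restarting closer to `0` feeds in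
`‖v(t₁)‖_∞ ≤ C/√(−t₁) → ∞`).

THE CARD'S ARGUMENT, RESCALED TO THE UNIT BALL (the form I recommend to provers; levels = an induction
on the strength of the singularity of `τ ↦ F(τ, 2)` at `τ → 0⁻`).  Put `F(u; τ, x₀, ρ) := ∫_{B_ρ(x₀)}|u(τ)|²`
and, for `u ∈ A_C`, write the local energy identity on `B₁(x₀) ⊂ B₂(x₀)` from the ENTRY TIME `−4` to
`t' ∈ (−1, 0)` (cut-off `φ`; smooth bounded mild solutions satisfy it classically with
`p = R_iR_j(u_iu_j) = p_near + p_far + c(τ)`, `p_near = R_iR_j(χ_{B₄}u⊗u)`, `p_far` harmonic in `B₄`,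
`c(τ)` killed by `div u = 0`):
  `F(t',1) ≤ F(−4,2) + c∫_{−4}^{t'} F(τ,2)dτ + c∫_{−4}^{t'} ‖u(τ)‖_∞ F(τ,4)dτ`
           `+ c∫_{−4}^{t'} sup_{B₂}|∇p_far(τ)| · F(τ,2)^{1/2} dτ`,   `sup_{B₂}|∇p_far| ≲ Σ_{k≥1} 2^{−4k} F(τ, 2^{k+1})`.
A "level" is a bound `F(u;τ,x₀,ρ) ≤ ρ·g(ρ/√(−τ))` valid for ALL `u ∈ A_C`, all `x₀`, all `τ < 0`, all
`ρ > 0` — by `isTypeIAncientMild_nsRescale`/`_translate` a bound proved for `ρ = 1` at all `(u, x₀, t')`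
IS a level.  Level 0 (Type-I rate): `g₀(m) = cC²m²`, i.e. `F(τ,2) ≲ C²/(−τ)`.  Feeding level `k` into the
three flux integrals over `τ ∈ (−4, t')`:
  level 0 ↦ cubic `C³∫(−τ)^{−3/2} ∼ C³(−t')^{−1/2}`, linear `C² log`, far pressure `∼ C³(−t')^{−1/2}`
            ⇒ level 1: `g₁(m) = A₁ m` (`A₁ ∼ C² + C³`);
  level 1 ↦ cubic `4CA₁∫(−τ)^{−1} = 4CA₁ log(4/(−t'))`, linear `≤ 16A₁`, far pressure `O(A₁^{3/2})`
            ⇒ level 2: `g₂(m) = A₂ log m + B₂`;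
  level 2 ↦ cubic `∫₀⁴ Cσ^{−1/2}(A₂ log(2/√σ) + B₂)dσ < ∞`, linear `< ∞`, far pressure
            `∫₀⁴ (A₂(1 + log σ^{−1/2}) + B₂)^{3/2} dσ < ∞` ⇒ level 3: `g₃ ≡ K(C)` = the crux.
Each level uses only the PREVIOUS level inside the flux integrals, so there is no circularity and no
smallness; the `L^∞`–BMO pressure bound alone (`‖p(τ)‖_BMO ≲ C²/(−τ)`) WOULD lose `log` at the last
step — the dyadic far-field split fed with the previous level is what avoids it.  I found no lost
logarithm.  To vendor: CZ `‖R_iR_jf‖_{3/2} ≲ ‖f‖_{3/2}`, the `|∇³Γ| ≲ |z|⁻⁴` far-field representation for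
bounded densities, and the local energy identity with this pressure for smooth bounded KNSS-mild solutions
(KNSS 2009 §4; Lemarié-Rieusset 2016 Ch. 11) — classical, but not in Mathlib.

CONSEQUENCES of the crux (sanity, not used): a nonzero `x₁,x₂`-periodic element would have
`F(−1,R) ≳ R²` — excluded outright; an `x₃`-periodic one (period `L`) gets `‖u(t)‖²_{L²(ℝ²×T_L)} ≤ 2KL`
for all `t < 0` (finite horizontal energy: an energy-method lever for HelicalEndLiouville, item #7);
fully periodic elements are `0` anyway (Poincaré + energy decay + Type-I). -/
theorem paperAudit : True := trivial

/-! ## §8 LINE `uloc-gronwall-transplant` (PICKED 2026-08-16; lead skeleton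
`Cruxes/FarPastLedger/Lines/uloc_gronwall_transplant.lean`, sha d1056eeb, 7 stubs, composition
sorry-free) — stub audit, X-safety of the `A_C`-quantified stubs, load-bearing hypotheses of HA -/

/-- STUB AUDIT (cycle 2; informal, each stub read back symbol by symbol and re-derived on paper).
Verdict first: ALL SEVEN STUBS ARE TRUE AS STATED; none is misstated; the composition
`FarPastLedger_of` is kernel-checked, so the line is sound iff the stubs are.  No `-- Targets` kill.

* COV `stub_fplCovering` (S) — `ρ ≥ 1`, `g` continuous `≥ 0`, unit-ball integrals `≤ B` ⇒
  `∫_{B_ρ(x₁)} g ≤ 125ρ³B`.  TRUE with room: the unit cubes centred on `x₁ + ℤ³` meeting `B_ρ(x₁)`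
  number `≤ (2ρ+2)³ ≤ 64ρ³` (`ρ ≥ 1`), each inside the unit ball about its centre (`√3/2 < 1`),
  `g ≥ 0`.  No junk (`g` continuous ⇒ integrable on balls; `B ≥ 0` is implied).  `ρ ≥ 1` is
  load-bearing (a normalised bump of radius `ρ < 1/5` has `∫_{B_ρ} g = B > 125ρ³B`) but the line only
  uses `ρ ∈ {2, 4, 3·2^{k+1}}`.
* SHELL `stub_fplFarShell` (S) — TRUE: dyadic shells `3·2ᵏ ≤ |y−x₁| < 3·2^{k+1}`, COV at
  `ρ = 3·2^{k+1}`, weights `(3·2ᵏ)⁻⁴`: `Σ_k 125·27·8·2^{3k}·3⁻⁴2^{−4k} B = (1000/3)·2·B`, so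
  `cS = 667` works; `IntegrableOn` on `(B₃)ᶜ` from `g ≤ M` and `∫_{|y|≥3}|y|⁻⁴ < ∞` (or from the shell
  sums by monotone convergence — the hypothesis `∃ M, g ≤ M` is CONVENIENT, NOT NECESSARY; it is
  available anyway: `g = ‖u(τ)‖² ≤ C²/(−τ)`).
* LFL `stub_fplLinearFluxLedger` (M, the lever) — TRUE, re-derived term by term from the tree's
  `IsClassicalNSSolutionOn.local_energy_identity_cutoff` on `B₂(x₀)` (cut-off `φ = 1` on `B₁(x₀)`,
  `supp φ ⊂ B₂(x₀)` OPEN ball — needed because NearFar's decomposition and `∇p₂`-bound live on the open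
  `ball x₀ 2`), dissipation dropped: deposit `∫|u(s')|²φ ≤ 1000F₀` (COV, `ρ=2`); `∫∫|u|²|Δφ| ≤ c·1000B(t'−s')`;
  cubic `∫∫|u|³|∇φ| ≤ c·1000B·∫C(−τ)^{−1/2} = 2000cBC(√(−s')−√(−t'))`; near pressure
  `2∫|p₁||u||∇φ| ≤ 2c‖p₁‖₂‖u‖_{L²(B₂)} ≤ 2c(c₀C²(−τ)⁻¹·8000B)^{1/2}(1000B)^{1/2} = c'√c₀·BC(−τ)^{−1/2}`
  (uses `C ≥ 0`, `IsTypeIAncientMild.nonneg`); far pressure: `p₂ − p₂(x₀)` on `B₂(x₀)` has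
  `|·| ≤ 2 sup_{B₂}‖∇p₂‖ ≤ 2c₀cS B` (mean value on the convex open ball — exactly the pointwise
  `DifferentiableAt` + `‖fderiv‖` form NearFar provides; Mathlib `Convex.norm_image_sub_le_of_norm_fderiv_le`)
  and the remaining velocity factor is spent on `‖u‖_∞ ≤ C/√(−τ)`: `≤ 4c₀cS B·c|B₂|C(−τ)^{−1/2}` —
  NOT on Cauchy–Schwarz (that would give `B^{3/2}`, non-linear); the constants `c + p₂(x₀)` drop by
  `∫(const)u·∇φ = 0` (div-free, compact support).  Hence `N = N(c₀, cS, φ)` INDEPENDENT of `C` ✓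
  (`C` enters only through the explicit factor), `N ≥ 1000 ≥ 1` covers `s' = t'` ✓.  Edge cases:
  `C = 0 ⇒ u ≡ 0`, both sides `≥ 0` ✓; `t₀ ≥ 0` ⇒ no `s'` ✓.
* GRADP `stub_fplPressureGradientBound` (S–M) — TRUE: `∇p(τ,·) = Δu − (u·∇)u − ∂ₜu` pointwise
  (`IsClassicalNSSolutionOn.momentum`; the window is open so `timeDerivWithin` is the two-sided
  derivative) and the right side is bounded in `x` at fixed `τ` by KNSS smoothing of bounded mild
  solutions (tree `knss2009_smoothing_holds`: all space–time derivatives of `u` bounded on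
  `[τ−δ, τ] × ℝ³`).  `∃ L` per `τ` is the weakest (correct) form; `L` never enters a constant.
* MD `stub_fplMeanDisplacement` (M; the ONE consumer of the Oseen identity H3) — TRUE on paper:
  test `u(t₂) − u(t₁) = (e^{hΔ} − 1)u(t₁) − B(u,u)` against `θ_r = θ(·/r)`; caloric part
  `|∫u(t₁)(e^{hΔ}θ_r − θ_r)| ≤ ‖u‖_∞ h‖Δθ_r‖₁ = O(r)`; Duhamel part: for `|y| ≤ 3r` move the divergence
  of the Oseen kernel onto `θ_r` (`|∇θ_r| ≤ c/r`, kernel of `e^{σΔ}ℙ` is `O((√σ+|z|)⁻³)` ⇒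
  `O(‖u‖²_∞ r² log(r/√σ))`), for `|y| ≥ 3r` use `|K(σ,z)| ≲ |z|⁻⁴` directly (`O(‖u‖²_∞ r³·r⁻¹)`);
  total `O(r² log r) = o(r³)` ✓.  WARNING FOR THE PROVER: the pointwise Koch–Tataru bound alone
  (tree `exists_norm_oseenKernel_three_le`, `|K| ≤ C₀(σ+|z|²)⁻²`) gives only `O(‖u‖²_∞ r³√h)` for the
  near part `|y| ≤ 3r` — NOT `o(r³)`; the cancellation from the derivative structure
  `K(σ,z)[a,b] = D_a[O(σ,·)b](z)` (tree `KochTataruPairing.oseenKernel_eq_fderiv_smul_add_integral`,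
  `OseenTensorRepresentation`) moved onto `θ_r` is ESSENTIAL there.  CONSISTENCY: for the parasitic non-mild `par` of §5a the bump average
  of `par(t₂) − par(t₁) = ((1−t₂)⁻¹ − (1−t₁)⁻¹)e₀ ≠ 0` does NOT vanish — MD is exactly where H3 bites.
* HA `stub_fplSlicePressure` (L, the lead's) — TRUE on paper: `h := q − RᵢRⱼ(wᵢwⱼ)` is harmonic with
  sub-quadratic mean growth (`∇q` bounded, `RᵢRⱼ(w⊗w) ∈ BMO`) ⇒ affine `c + ⟪a,·⟫`; near part
  `p₁ = RᵢRⱼ(1_{B₄}wᵢwⱼ)`, `‖p₁‖₂ ≤ c M‖w‖_{L²(B₄)}` (Plancherel); far part off its support via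
  `|∇³Γ| ≲ |z|⁻⁴` (`|x−y| ≥ |y−x₀|/3` for `x ∈ B₂`, `|y−x₀| ≥ 3`); `avg_r(∇q) − a = avg_r(∇q₀) =
  −(∫θ_r)⁻¹∫∇θ_r(q₀ − m) = O(‖q₀‖_BMO/r) = O(M²/r)` ✓.  Junk audit: `M < 0` unsatisfiable, `M = 0 ⇒
  w = 0 ⇒ q` affine and `avg_r(∇q) = a` exactly (`∫θ_r > 0` for `r ≥ 1`) ✓; the far integrand
  `‖w‖²‖y−x₀‖⁻⁴` is integrable on `(B₃)ᶜ` for bounded `w` (no Bochner-junk `0`) ✓; `c₀` uniform in `L` ✓.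
  LOAD-BEARING: the gradient bound `‖∇q‖ ≤ L` (§8c, `slicePressure_false_without_gradBound`: `w = 0`,
  `q = y₀y₁`); divergence-freeness (INFORMAL witness, not formalised — needs a Newtonian potential:
  `w = ε(a(x)sin(nx₂), b(x)cos(nx₂), 0)` with bumps `a, b` supported in `B₃(0)`: `(div w)w₁` has the
  LOW-frequency part `−ε²n·ab/2`, so `q ∋ ε²n·(−Δ)⁻¹∂₁(ab/2)`, a fixed non-affine profile of size
  `ε²n ≫ M² = ε²`, while HA's near bound is `O(√c₀ ε²)` and its far bound vanishes — for div-free `w`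
  the source is the pure double divergence `∂ᵢ∂ⱼ(wᵢwⱼ)` and no such term exists).
* PIN `stub_fplPinning` (M) — TRUE: `A_r(τ) := avg_r(∇p(τ))` is continuous in `τ` (`∇p` jointly
  continuous: `smooth_pressure`), `A_r → a` uniformly on compact `[t₁,t₂] ⊂ (t₀,0)` (rate `κ/r`, `κ`
  locally bounded) ⇒ `a` continuous on the window; `∫_{t₁}^{t₂}A_r = avg_r∫(Δu − (u·∇)u)dτ −
  (∫θ_r)⁻¹∫θ_r(u(t₂) − u(t₁))` (momentum + FTC in `τ`, `u` jointly smooth) with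
  `avg_r(Δu) = O(C(−τ)^{−1/2}r⁻²)`, `avg_r((u·∇)u) = avg_r(∇·(u⊗u)) = O(C²(−τ)⁻¹r⁻¹)` (parts onto
  `θ_r`; div-free) and the displacement term `→ 0` by MD ⇒ `∫_{t₁}^{t₂} a = 0` for all
  `t₀ < t₁ < t₂ < 0` ⇒ `a ≡ 0` ✓.  (`a`, `κ` arbitrary subject to the rate hypothesis: `a(τ)` is then
  determined as `lim A_r(τ)`, fine.)
* X-SAFETY (§8b): LFL, GRADP, MD, PIN quantify over `A_C`; each FOLLOWS from Liouville over the class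
  (they hold at `u ≡ 0`: the classical pressure of the zero velocity has `∇p = 0` on the window), so a
  counterexample to any of them is a nonzero element of some `A_C` = a solution of the open Type-I
  Liouville problem — no explicit field can refute them, exactly as for the crux (§3).  Only COV, SHELL
  (elementary) and HA (harmonic analysis, no `A_C`) are exposed to small models, and all three check out.
* JOINT SUFFICIENCY: kernel-checked in the skeleton (`nearFar_window`, `unitWindow_of_ledger`,
  `crux_of_unitWindow`, `FarPastLedger_of`); the Disproof's `_false_without_mild` enters at MD,
  `_false_without_typeI` at the crossing number inside LFL/`doubling_step`, `_false_on_window` at the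
  entry time `−1` of `unitWindow_of_ledger` (Type-I a-priori bound at `t = −1` needs `u` defined at
  `t ≤ −1`, i.e. ancientness after rescaling) — every load-bearing hypothesis of §5 is consumed somewhere ✓.
ADVERSARY VERDICT ON THE LINE: sound; expected cost as labelled (HA L, LFL/MD/PIN M, GRADP S–M, COV/SHELL S). -/
theorem lineAudit_ulocGronwallTransplant : True := trivial

/-! ### §8b X-safety of LFL, GRADP, MD, PIN

#### The pressure of the zero velocity has zero gradient -/

/-- **Momentum equation at `u ≡ 0`.** If `(u, p)` is a classical Navier–Stokes pair (`ν = 1`, `f = 0`)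
on the open window `(t₀, 0)` and `u(t, ·) = 0` for all `t < 0`, then `∇p(τ, ·) = 0` for `τ` in the
window: `∂ₜu`, `(u·∇)u` and `Δu` all vanish. -/
theorem gradient_pressure_eq_zero_of_velocity_eq_zero {u : ℝ → ℝ³ → ℝ³} {p : ℝ → ℝ³ → ℝ} {t₀ : ℝ}
    (hcl : IsClassicalNSSolutionOn (Ioo t₀ 0) 1 0 u p) (h0 : ∀ t < 0, ∀ x, u t x = 0)
    {τ : ℝ} (hτ : τ ∈ Ioo t₀ 0) (x : ℝ³) : gradient (p τ) x = 0 := by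
  have hmom := hcl.momentum τ hτ x
  have hslice : u τ = fun _ => (0 : ℝ³) := funext (h0 τ hτ.2)
  have hder : timeDerivWithin (Ioo t₀ 0) u τ x = 0 := by
    rw [timeDerivWithin_apply]
    have hc : EqOn (fun s => u s x) (fun _ => (0 : ℝ³)) (Ioo t₀ 0) := fun s hs => h0 s hs.2 x
    rw [derivWithin_congr hc (h0 τ hτ.2 x)]
    simp
  have hconv : convect (u τ) (u τ) x = 0 := by
    rw [convect_apply, hslice]
    simp
  have hlap : (Δ (u τ)) x = 0 := by
    rw [hslice]
    exact congrFun (InnerProductSpace.laplacian_const (E := ℝ³) (c := (0 : ℝ³))) x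
  rw [hder, hconv, hlap] at hmom
  simpa using hmom

/-- Consequently `fderiv ℝ (p τ) x = 0` (the dual of the gradient). -/
theorem fderiv_pressure_eq_zero_of_velocity_eq_zero {u : ℝ → ℝ³ → ℝ³} {p : ℝ → ℝ³ → ℝ} {t₀ : ℝ}
    (hcl : IsClassicalNSSolutionOn (Ioo t₀ 0) 1 0 u p) (h0 : ∀ t < 0, ∀ x, u t x = 0)
    {τ : ℝ} (hτ : τ ∈ Ioo t₀ 0) (x : ℝ³) : fderiv ℝ (p τ) x = 0 := by
  have hg := gradient_pressure_eq_zero_of_velocity_eq_zero hcl h0 hτ x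
  have e := (InnerProductSpace.toDual ℝ ℝ³).apply_symm_apply (fderiv ℝ (p τ) x)
  rw [← e]
  change (InnerProductSpace.toDual ℝ ℝ³) (gradient (p τ) x) = 0
  rw [hg, map_zero]

/-! #### GRADP -/

/-- VERBATIM the statement of stub GRADP `stub_fplPressureGradientBound`. -/
def StubGRADPStatement : Prop :=
  ∀ (C : ℝ) (u : ℝ → EuclideanSpace ℝ (Fin 3) → EuclideanSpace ℝ (Fin 3)),
    Literature.Analysis.FluidPDE.IsTypeIAncientMild C u →
    ∀ (t₀ : ℝ) (p : ℝ → EuclideanSpace ℝ (Fin 3) → ℝ),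
    Literature.Analysis.FluidPDE.IsClassicalNSSolutionOn (Set.Ioo t₀ 0) 1 0 u p →
    ∀ τ ∈ Set.Ioo t₀ 0, ∃ L : ℝ, ∀ x : EuclideanSpace ℝ (Fin 3), ‖fderiv ℝ (p τ) x‖ ≤ L

/-- **GRADP is X-safe**: it holds over a class all of whose elements vanish (`L = 0`). -/
theorem stubGRADP_of_classLiouville (hL : ClassLiouville) : StubGRADPStatement := by
  intro C u hu t₀ p hp τ hτ
  refine ⟨0, fun x => ?_⟩
  rw [fderiv_pressure_eq_zero_of_velocity_eq_zero hp (hL C u hu) hτ x, norm_zero]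

/-! #### MD -/

/-- VERBATIM the statement of stub MD `stub_fplMeanDisplacement`. -/
def StubMDStatement : Prop :=
  ∀ (C : ℝ) (u : ℝ → EuclideanSpace ℝ (Fin 3) → EuclideanSpace ℝ (Fin 3)),
    Literature.Analysis.FluidPDE.IsTypeIAncientMild C u →
    ∀ t₁ t₂ : ℝ, t₁ < t₂ → t₂ < 0 →
    Filter.Tendsto (fun r : ℝ => (r ^ 3)⁻¹ •
      ∫ x, (((⟨1, 2, zero_lt_one, one_lt_two⟩ : ContDiffBump (0 : EuclideanSpace ℝ (Fin 3))) :
          EuclideanSpace ℝ (Fin 3) → ℝ) (r⁻¹ • x)) • (u t₂ x - u t₁ x))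
      Filter.atTop (nhds 0)

/-- **MD is X-safe**: the displacement of the zero field vanishes identically. -/
theorem stubMD_of_classLiouville (hL : ClassLiouville) : StubMDStatement := by
  intro C u hu t₁ t₂ h12 h2
  have h1 : t₁ < 0 := h12.trans h2
  have hzero : (fun r : ℝ => (r ^ 3)⁻¹ •
      ∫ x, (((⟨1, 2, zero_lt_one, one_lt_two⟩ : ContDiffBump (0 : ℝ³)) : ℝ³ → ℝ) (r⁻¹ • x)) •
        (u t₂ x - u t₁ x)) = fun _ => 0 := by
    funext r
    have : ∀ x, u t₂ x - u t₁ x = 0 := fun x => by rw [hL C u hu t₂ h2 x, hL C u hu t₁ h1 x, sub_zero]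
    simp only [this, smul_zero, integral_zero]
  rw [hzero]
  exact tendsto_const_nhds

/-! #### PIN -/

/-- VERBATIM the statement of stub PIN `stub_fplPinning`. -/
def StubPINStatement : Prop :=
  ∀ (C : ℝ) (u : ℝ → EuclideanSpace ℝ (Fin 3) → EuclideanSpace ℝ (Fin 3)),
    Literature.Analysis.FluidPDE.IsTypeIAncientMild C u →
    ∀ (t₀ : ℝ) (p : ℝ → EuclideanSpace ℝ (Fin 3) → ℝ),
    Literature.Analysis.FluidPDE.IsClassicalNSSolutionOn (Set.Ioo t₀ 0) 1 0 u p →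
    ∀ (a : ℝ → EuclideanSpace ℝ (Fin 3)) (κ : ℝ → ℝ),
    (∀ τ ∈ Set.Ioo t₀ 0, ∀ r : ℝ, 1 ≤ r →
      ‖(∫ x, ((⟨1, 2, zero_lt_one, one_lt_two⟩ : ContDiffBump (0 : EuclideanSpace ℝ (Fin 3))) :
            EuclideanSpace ℝ (Fin 3) → ℝ) (r⁻¹ • x))⁻¹ •
          (∫ x, (((⟨1, 2, zero_lt_one, one_lt_two⟩ :
              ContDiffBump (0 : EuclideanSpace ℝ (Fin 3))) : EuclideanSpace ℝ (Fin 3) → ℝ)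
                (r⁻¹ • x)) • gradient (p τ) x) - a τ‖ ≤ κ τ / r) →
    (∀ τ₁ τ₂ : ℝ, t₀ < τ₁ → τ₂ < 0 → ∃ K : ℝ, ∀ τ ∈ Set.Icc τ₁ τ₂, κ τ ≤ K) →
    (∀ t₁ t₂ : ℝ, t₁ < t₂ → t₂ < 0 →
      Filter.Tendsto (fun r : ℝ => (r ^ 3)⁻¹ •
        ∫ x, (((⟨1, 2, zero_lt_one, one_lt_two⟩ : ContDiffBump (0 : EuclideanSpace ℝ (Fin 3))) :
            EuclideanSpace ℝ (Fin 3) → ℝ) (r⁻¹ • x)) • (u t₂ x - u t₁ x))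
        Filter.atTop (nhds 0)) →
    ∀ τ ∈ Set.Ioo t₀ 0, a τ = 0

/-- `‖v‖ ≤ κ / r` for all `r ≥ 1` forces `v = 0`. -/
theorem eq_zero_of_norm_le_div {v : ℝ³} {κ : ℝ} (h : ∀ r : ℝ, 1 ≤ r → ‖v‖ ≤ κ / r) : v = 0 := by
  have hlim : Tendsto (fun r : ℝ => κ / r) atTop (𝓝 0) := by
    simpa [div_eq_mul_inv] using tendsto_inv_atTop_zero.const_mul κ
  have hle : ‖v‖ ≤ 0 :=
    le_of_tendsto_of_tendsto tendsto_const_nhds hlim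
      ((eventually_ge_atTop (1 : ℝ)).mono fun r hr => h r hr)
  exact norm_le_zero_iff.1 hle

/-- **PIN is X-safe**: over a class of vanishing elements every classical pressure has `∇p = 0` on
the window, so the scale-`r` averages vanish and the rate hypothesis alone pins `a τ = 0`. -/
theorem stubPIN_of_classLiouville (hL : ClassLiouville) : StubPINStatement := by
  intro C u hu t₀ p hp a κ hrate _ _ τ hτ
  refine eq_zero_of_norm_le_div (κ := κ τ) fun r hr => ?_
  have key := hrate τ hτ r hr
  have hg : ∀ x, gradient (p τ) x = 0 := fun x =>
    gradient_pressure_eq_zero_of_velocity_eq_zero hp (hL C u hu) hτ x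
  simp only [hg, smul_zero, integral_zero, zero_sub, norm_neg] at key
  exact key

/-! #### LFL -/

/-- VERBATIM the statement of stub LFL `stub_fplLinearFluxLedger` (the lever). -/
def StubLFLStatement : Prop :=
  ∀ (c₀ cS : ℝ), ∃ N : ℝ, 0 ≤ N ∧
    ∀ (C : ℝ) (u : ℝ → EuclideanSpace ℝ (Fin 3) → EuclideanSpace ℝ (Fin 3)),
    Literature.Analysis.FluidPDE.IsTypeIAncientMild C u →
    ∀ (t₀ : ℝ) (p : ℝ → EuclideanSpace ℝ (Fin 3) → ℝ),
    Literature.Analysis.FluidPDE.IsClassicalNSSolutionOn (Set.Ioo t₀ 0) 1 0 u p →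
    (∀ τ ∈ Set.Ioo t₀ 0, ∀ x₀ : EuclideanSpace ℝ (Fin 3),
      ∃ (c : ℝ) (p₁ p₂ : EuclideanSpace ℝ (Fin 3) → ℝ),
      (∀ x ∈ Metric.ball x₀ 2, p τ x = c + p₁ x + p₂ x) ∧
      MeasureTheory.MemLp p₁ 2 MeasureTheory.volume ∧
      ∫ x, p₁ x ^ 2 ≤ c₀ * (C ^ 2 / (-τ)) * ∫ x in Metric.ball x₀ 4, ‖u τ x‖ ^ 2 ∧
      ∀ x ∈ Metric.ball x₀ 2, DifferentiableAt ℝ p₂ x ∧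
        ‖fderiv ℝ p₂ x‖ ≤ c₀ * ∫ y in (Metric.ball x₀ 3)ᶜ, ‖u τ y‖ ^ 2 / ‖y - x₀‖ ^ 4) →
    (∀ (ρ : ℝ), 1 ≤ ρ → ∀ (g : EuclideanSpace ℝ (Fin 3) → ℝ), Continuous g → (∀ x, 0 ≤ g x) →
      ∀ (B : ℝ) (x₁ : EuclideanSpace ℝ (Fin 3)),
      (∀ z : EuclideanSpace ℝ (Fin 3), ∫ x in Metric.ball z 1, g x ≤ B) →
      ∫ x in Metric.ball x₁ ρ, g x ≤ 125 * ρ ^ 3 * B) →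
    (∀ (g : EuclideanSpace ℝ (Fin 3) → ℝ), Continuous g → (∀ x, 0 ≤ g x) → (∃ M : ℝ, ∀ x, g x ≤ M) →
      ∀ (B : ℝ) (x₁ : EuclideanSpace ℝ (Fin 3)),
      (∀ z : EuclideanSpace ℝ (Fin 3), ∫ x in Metric.ball z 1, g x ≤ B) →
      MeasureTheory.IntegrableOn (fun y => g y / ‖y - x₁‖ ^ 4) (Metric.ball x₁ 3)ᶜ
          MeasureTheory.volume ∧
        ∫ y in (Metric.ball x₁ 3)ᶜ, g y / ‖y - x₁‖ ^ 4 ≤ cS * B) →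
    ∀ (s' t' : ℝ), t₀ < s' → s' ≤ t' → t' < 0 → ∀ (F₀ B : ℝ), 0 ≤ B →
    (∀ z : EuclideanSpace ℝ (Fin 3), ∫ x in Metric.ball z 1, ‖u s' x‖ ^ 2 ≤ F₀) →
    (∀ τ ∈ Set.Icc s' t', ∀ z : EuclideanSpace ℝ (Fin 3), ∫ x in Metric.ball z 1, ‖u τ x‖ ^ 2 ≤ B) →
    ∀ x₀ : EuclideanSpace ℝ (Fin 3),
      ∫ x in Metric.ball x₀ 1, ‖u t' x‖ ^ 2 ≤
        N * F₀ + N * B * ((t' - s') + C * (Real.sqrt (-s') - Real.sqrt (-t')))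

/-- **LFL is X-safe**: with `N = 1` it holds over a class of vanishing elements (the left side is `0`,
the right side is `≥ 0`: `F₀ ≥ 0` from its own hypothesis, `B ≥ 0`, `t' ≥ s'`, `C ≥ 0`,
`√(−s') ≥ √(−t')`). -/
theorem stubLFL_of_classLiouville (hL : ClassLiouville) : StubLFLStatement := by
  intro c₀ cS
  refine ⟨1, zero_le_one, ?_⟩
  intro C u hu t₀ p _ _ _ _ s' t' _ hst ht F₀ B hB hF _ x₀
  have hs : s' < 0 := lt_of_le_of_lt hst ht
  have h0 : ∀ x, ‖u t' x‖ ^ 2 = 0 := fun x => by rw [hL C u hu t' ht x, norm_zero]; ring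
  have hF₀ : 0 ≤ F₀ := le_trans (integral_nonneg fun x => by positivity) (hF x₀)
  have hC : 0 ≤ C := hu.nonneg
  have hsq : Real.sqrt (-t') ≤ Real.sqrt (-s') := Real.sqrt_le_sqrt (by linarith)
  simp only [h0, integral_zero, one_mul]
  have : 0 ≤ B * ((t' - s') + C * (Real.sqrt (-s') - Real.sqrt (-t'))) := by
    apply mul_nonneg hB
    have := mul_nonneg hC (sub_nonneg.2 hsq)
    linarith
  linarith

/-! #### Contrapositives: a counterexample to any of the four is a nonzero element of some `A_C` -/

/-- Unfolding `¬ ClassLiouville`. -/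
theorem exists_ne_zero_of_not_classLiouville (h : ¬ ClassLiouville) :
    ∃ (C : ℝ) (u : ℝ → ℝ³ → ℝ³), IsTypeIAncientMild C u ∧ ∃ t < 0, ∃ x, u t x ≠ 0 := by
  unfold ClassLiouville at h
  push Not at h
  exact h

/-- A counterexample to LFL is a nonzero element of some `A_C` (an open-problem witness). -/
theorem exists_ne_zero_of_not_stubLFL (h : ¬ StubLFLStatement) :
    ∃ (C : ℝ) (u : ℝ → ℝ³ → ℝ³), IsTypeIAncientMild C u ∧ ∃ t < 0, ∃ x, u t x ≠ 0 :=
  exists_ne_zero_of_not_classLiouville fun hL => h (stubLFL_of_classLiouville hL)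

/-- A counterexample to GRADP is a nonzero element of some `A_C` (an open-problem witness). -/
theorem exists_ne_zero_of_not_stubGRADP (h : ¬ StubGRADPStatement) :
    ∃ (C : ℝ) (u : ℝ → ℝ³ → ℝ³), IsTypeIAncientMild C u ∧ ∃ t < 0, ∃ x, u t x ≠ 0 :=
  exists_ne_zero_of_not_classLiouville fun hL => h (stubGRADP_of_classLiouville hL)

/-- A counterexample to MD is a nonzero element of some `A_C` (an open-problem witness). -/
theorem exists_ne_zero_of_not_stubMD (h : ¬ StubMDStatement) :
    ∃ (C : ℝ) (u : ℝ → ℝ³ → ℝ³), IsTypeIAncientMild C u ∧ ∃ t < 0, ∃ x, u t x ≠ 0 :=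
  exists_ne_zero_of_not_classLiouville fun hL => h (stubMD_of_classLiouville hL)

/-- A counterexample to PIN is a nonzero element of some `A_C` (an open-problem witness). -/
theorem exists_ne_zero_of_not_stubPIN (h : ¬ StubPINStatement) :
    ∃ (C : ℝ) (u : ℝ → ℝ³ → ℝ³), IsTypeIAncientMild C u ∧ ∃ t < 0, ∃ x, u t x ≠ 0 :=
  exists_ne_zero_of_not_classLiouville fun hL => h (stubPIN_of_classLiouville hL)


/-! ### §8c HA: the gradient bound `‖∇q‖ ≤ L` is load-bearing

#### Coordinate calculus: the harmonic quadratic `y₀ y₁` -/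

/-- `D(y ↦ yᵢ)(x) h = hᵢ`. -/
theorem fderiv_coord_apply (i : Fin 3) (x h : ℝ³) :
    fderiv ℝ (fun y : ℝ³ => y i) x h = h i := by
  have : (fun y : ℝ³ => y i) = ⇑(EuclideanSpace.proj (𝕜 := ℝ) i) := rfl
  rw [this, ContinuousLinearMap.fderiv]
  rfl

/-- Coordinates are smooth. -/
theorem contDiff_coord {n : WithTop ℕ∞} (i : Fin 3) : ContDiff ℝ n (fun y : ℝ³ => y i) :=
  (EuclideanSpace.proj (𝕜 := ℝ) i).contDiff

/-- `Δ(y ↦ yᵢ) = 0`. -/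
theorem laplacian_coord (i : Fin 3) (x : ℝ³) : (Δ (fun y : ℝ³ => y i)) x = 0 := by
  rw [laplacian_eq_sum_fderiv_fderiv (EuclideanSpace.basisFun (Fin 3) ℝ) (contDiff_coord i) x]
  refine Finset.sum_eq_zero fun j _ => ?_
  have : (fun y : ℝ³ => fderiv ℝ (fun y : ℝ³ => y i) y ((EuclideanSpace.basisFun (Fin 3) ℝ) j)) =
      fun _ => ((EuclideanSpace.basisFun (Fin 3) ℝ) j) i := by
    funext y; exact fderiv_coord_apply i y _
  rw [this, fderiv_fun_const]
  rfl

/-- The harmonic quadratic `q(y) = y₀ y₁`. -/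
def harmonicQuadratic : ℝ³ → ℝ := fun y => y 0 * y 1

/-- `y₀y₁` is smooth. -/
theorem contDiff_harmonicQuadratic {n : WithTop ℕ∞} : ContDiff ℝ n harmonicQuadratic :=
  (contDiff_coord 0).mul (contDiff_coord 1)

/-- `Δ(y₀y₁) = 0` (Leibniz rule `laplacian_mul_eq`, `Δyᵢ = 0`, `⟪e₀, e₁⟫ = 0`). -/
theorem laplacian_harmonicQuadratic (x : ℝ³) : (Δ harmonicQuadratic) x = 0 := by
  show (Δ fun y : ℝ³ => y 0 * y 1) x = 0
  rw [laplacian_mul_eq (EuclideanSpace.basisFun (Fin 3) ℝ) (contDiff_coord 0) (contDiff_coord 1) x,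
    laplacian_coord, laplacian_coord]
  simp only [fderiv_coord_apply, mul_zero, zero_add, Fin.sum_univ_three, EuclideanSpace.basisFun_apply]
  simp

/-- The test points `s e₀ + t e₁`. -/
def testPoint (s t : ℝ) : ℝ³ := EuclideanSpace.single 0 s + EuclideanSpace.single 1 t

/-- `q(s e₀ + t e₁) = s t`. -/
theorem harmonicQuadratic_testPoint (s t : ℝ) : harmonicQuadratic (testPoint s t) = s * t := by
  simp [harmonicQuadratic, testPoint]

/-- `‖s e₀ + t e₁‖ ≤ |s| + |t|`. -/
theorem norm_testPoint_le (s t : ℝ) : ‖testPoint s t‖ ≤ |s| + |t| := by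
  unfold testPoint
  refine (norm_add_le _ _).trans ?_
  simp

/-- `⟪a, s e₀ + t e₁⟫ = s a₀ + t a₁`. -/
theorem inner_testPoint (a : ℝ³) (s t : ℝ) : inner ℝ a (testPoint s t) = s * a 0 + t * a 1 := by
  simp [testPoint, inner_add_right, EuclideanSpace.inner_single_right]

/-- The four points `(±½, ±½, 0)` lie in `B₂(0)`. -/
theorem testPoint_mem_ball {s t : ℝ} (hs : |s| = 1 / 2) (ht : |t| = 1 / 2) :
    testPoint s t ∈ ball (0 : ℝ³) 2 := by
  rw [mem_ball_zero_iff]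
  refine (norm_testPoint_le _ _).trans_lt ?_
  rw [hs, ht]; norm_num

/-! #### No near/far decomposition of `y₀y₁` with trivial near and far parts -/

/-- **Core obstruction.** `y₀y₁` is not of the form `c + ⟪a,·⟫ + p₁ + p₂` on `B₂(0)` with `p₁ = 0`
in `L²(ℝ³)` and `p₂` differentiable with `∇p₂ = 0` on `B₂(0)`: `p₂` is then constant on the ball,
`p₁` vanishes a.e., so the continuous function `y₀y₁ − c − ⟪a,y⟫ − p₂` vanishes identically on the
open ball (`Measure.eqOn_open_of_ae_eq`), which the second difference over `(±½, ±½, 0)` refutes. -/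
theorem no_nearFar_decomposition_harmonicQuadratic :
    ¬ ∃ (a : ℝ³) (c : ℝ) (p₁ p₂ : ℝ³ → ℝ),
      (∀ x ∈ ball (0 : ℝ³) 2, harmonicQuadratic x = c + inner ℝ a x + p₁ x + p₂ x) ∧
      MemLp p₁ 2 volume ∧ ∫ x, p₁ x ^ 2 ≤ 0 ∧
      ∀ x ∈ ball (0 : ℝ³) 2, DifferentiableAt ℝ p₂ x ∧ ‖fderiv ℝ p₂ x‖ ≤ 0 := by
  rintro ⟨a, c, p₁, p₂, hdec, hmem, hint, hfar⟩
  -- `p₂` is constant on the ball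
  have hconst : ∀ x ∈ ball (0 : ℝ³) 2, p₂ x = p₂ 0 := by
    intro x hx
    have key := Convex.norm_image_sub_le_of_norm_fderiv_le (𝕜 := ℝ) (f := p₂) (C := 0)
      (fun y hy => (hfar y hy).1) (fun y hy => (hfar y hy).2) (convex_ball (0 : ℝ³) 2)
      (mem_ball_self two_pos) hx
    rw [zero_mul, norm_le_zero_iff, sub_eq_zero] at key
    exact key
  -- `p₁ = 0` a.e.
  have hsq_int : Integrable (fun x => p₁ x ^ 2) volume := hmem.integrable_sq
  have hsq_zero : ∫ x, p₁ x ^ 2 = 0 :=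
    le_antisymm hint (integral_nonneg fun x => sq_nonneg _)
  have hp1ae : ∀ᵐ x ∂(volume : Measure ℝ³), p₁ x = 0 := by
    have h := (integral_eq_zero_iff_of_nonneg (fun x => sq_nonneg (p₁ x)) hsq_int).1 hsq_zero
    filter_upwards [h] with x hx
    simpa using hx
  -- the continuous remainder vanishes a.e. on the ball, hence everywhere on it
  set g : ℝ³ → ℝ := fun x => harmonicQuadratic x - c - inner ℝ a x - p₂ x with hg
  have hgae : g =ᵐ[volume.restrict (ball (0 : ℝ³) 2)] fun _ => (0 : ℝ) := by
    have h1 : ∀ᵐ x ∂(volume.restrict (ball (0 : ℝ³) 2)), p₁ x = 0 := ae_restrict_of_ae hp1ae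
    have h2 : ∀ᵐ x ∂(volume.restrict (ball (0 : ℝ³) 2)), x ∈ ball (0 : ℝ³) 2 :=
      ae_restrict_mem measurableSet_ball
    filter_upwards [h1, h2] with x hx1 hx2
    have := hdec x hx2
    simp only [hg]
    linarith
  have hgcont : ContinuousOn g (ball (0 : ℝ³) 2) := by
    refine ((contDiff_harmonicQuadratic (n := 0)).continuous.continuousOn.sub continuousOn_const).sub
      (continuous_const.inner continuous_id).continuousOn |>.sub ?_
    exact fun x hx => (hfar x hx).1.continuousAt.continuousWithinAt
  have hg0 : EqOn g (fun _ => (0 : ℝ)) (ball (0 : ℝ³) 2) :=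
    Measure.eqOn_open_of_ae_eq hgae isOpen_ball hgcont continuousOn_const
  -- evaluate at the four points `(±½, ±½, 0)`
  have habs : |(1 / 2 : ℝ)| = 1 / 2 := abs_of_pos (by norm_num)
  have habs' : |(-(1 / 2) : ℝ)| = 1 / 2 := by rw [abs_neg, habs]
  have ev : ∀ s t : ℝ, |s| = 1 / 2 → |t| = 1 / 2 → s * t - c - (s * a 0 + t * a 1) - p₂ 0 = 0 := by
    intro s t hs ht
    have hmem' := testPoint_mem_ball hs ht
    have h := hg0 hmem'
    simp only [hg, harmonicQuadratic_testPoint, inner_testPoint, hconst _ hmem'] at h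
    exact h
  have e1 := ev (1 / 2) (1 / 2) habs habs
  have e2 := ev (-(1 / 2)) (-(1 / 2)) habs' habs'
  have e3 := ev (1 / 2) (-(1 / 2)) habs habs'
  have e4 := ev (-(1 / 2)) (1 / 2) habs' habs
  linarith

/-! #### The stub with the gradient bound deleted is false -/

/-- The fixed bump of the line (Mathlib's smooth bump at `0`, `= 1` on `B̄₁`, supported in `B₂`). -/
def lineBump : ℝ³ → ℝ := (⟨1, 2, zero_lt_one, one_lt_two⟩ : ContDiffBump (0 : ℝ³))

/-- VERBATIM the statement of the lead's stub `stub_fplSlicePressure` (skeleton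
`Cruxes/FarPastLedger/Lines/uloc_gronwall_transplant.lean`, sha d1056eeb) with the single hypothesis
`(∀ x, ‖fderiv ℝ q x‖ ≤ L)` (and its parameter `L`) DELETED. -/
def SlicePressureWithoutGradBound : Prop :=
  ∃ c₀ : ℝ, 0 ≤ c₀ ∧
    ∀ (M : ℝ) (w : ℝ³ → ℝ³) (q : ℝ³ → ℝ),
    ContDiff ℝ (⊤ : ℕ∞) w → ContDiff ℝ (⊤ : ℕ∞) q → VectorCalculus.IsDivFree w →
    (∀ x, ‖w x‖ ≤ M) →
    (∀ x, Laplacian.laplacian q x = -VectorCalculus.divergence (convect w w) x) →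
    ∃ a : ℝ³,
      (∀ x₀ : ℝ³, ∃ (c : ℝ) (p₁ p₂ : ℝ³ → ℝ),
        (∀ x ∈ ball x₀ 2, q x = c + inner ℝ a x + p₁ x + p₂ x) ∧ MemLp p₁ 2 volume ∧
        ∫ x, p₁ x ^ 2 ≤ c₀ * M ^ 2 * ∫ x in ball x₀ 4, ‖w x‖ ^ 2 ∧
        ∀ x ∈ ball x₀ 2, DifferentiableAt ℝ p₂ x ∧
          ‖fderiv ℝ p₂ x‖ ≤ c₀ * ∫ y in (ball x₀ 3)ᶜ, ‖w y‖ ^ 2 / ‖y - x₀‖ ^ 4) ∧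
      ∀ r : ℝ, 1 ≤ r →
        ‖(∫ x, lineBump (r⁻¹ • x))⁻¹ • (∫ x, (lineBump (r⁻¹ • x)) • gradient q x) - a‖ ≤ c₀ * M ^ 2 / r

/-- The zero field is divergence free. -/
theorem isDivFree_zero : VectorCalculus.IsDivFree (fun _ : ℝ³ => (0 : ℝ³)) := fun x => by
  simp [VectorCalculus.divergence]

/-- `(0·∇)0 = 0`. -/
theorem convect_zero : convect (fun _ : ℝ³ => (0 : ℝ³)) (fun _ : ℝ³ => (0 : ℝ³)) = fun _ => 0 := by
  funext x
  simp [convect]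

/-- **The gradient bound `‖∇q‖ ≤ L` of stub HA is load-bearing**: with it deleted the slice lemma
is FALSE — witness `M = 0`, `w = 0`, `q = y₀y₁` (harmonic, so `Δq = −div((w·∇)w) = 0`), ball
`B₂(0)`: the near bound forces `p₁ = 0` in `L²`, the far bound forces `∇p₂ = 0` on `B₂(0)`, and
`no_nearFar_decomposition_harmonicQuadratic` applies.  So HA must consume GRADP
(`stub_fplPressureGradientBound`): bounded `∇q` is what kills the harmonic polynomials of degree
`≥ 2` in the kernel of the pressure Poisson equation. -/
theorem slicePressure_false_without_gradBound : ¬ SlicePressureWithoutGradBound := by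
  rintro ⟨c₀, -, h⟩
  obtain ⟨a, hnear, -⟩ := h 0 (fun _ => 0) harmonicQuadratic contDiff_const contDiff_harmonicQuadratic
    isDivFree_zero (fun x => by simp) (fun x => by
      rw [laplacian_harmonicQuadratic x, convect_zero]
      simp [VectorCalculus.divergence])
  obtain ⟨c, p₁, p₂, hdec, hmem, hint, hfar⟩ := hnear 0
  refine no_nearFar_decomposition_harmonicQuadratic ⟨a, c, p₁, p₂, hdec, hmem, ?_, fun x hx => ⟨(hfar x hx).1, ?_⟩⟩
  · simpa using hint
  · have := (hfar x hx).2
    simpa using this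


/-! ## `-- Targets` (payload.targets / stuck_stubs: none at cycle 2) -/

-- Targets: the seven registered stubs of the picked line were attacked as if targets (§8):
--   stub_fplCovering ........ TRUE (elementary); `ρ ≥ 1` load-bearing but only `ρ ≥ 2` is used
--   stub_fplFarShell ........ TRUE (cS = 667 works); `∃ M, g ≤ M` decorative
--   stub_fplLinearFluxLedger  TRUE on paper, X-safe (§8b `stubLFL_of_classLiouville`)
--   stub_fplPressureGradientBound TRUE (KNSS smoothing), X-safe (§8b)
--   stub_fplMeanDisplacement  TRUE on paper (O(r² log r)), X-safe (§8b); H3 consumed here only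
--   stub_fplSlicePressure ... TRUE on paper; `‖∇q‖ ≤ L` load-bearing (§8c, FORMAL), div-free
--                             load-bearing (§8a, informal oscillatory witness)
--   stub_fplPinning ......... TRUE on paper, X-safe (§8b)
-- No stub broken.  Landed / proposed Negative lemmas: Negative/LoadBearing (accepted p80826);
-- Negative/Scaling p85515, Negative/SlicePressure p84887, Negative/XSafeStubs p85260 (submitted, review-queued).

/-- Targets ledger (cycle 2): nothing to kill; see the comment block above and §8. -/
theorem targets_cycle2 : True := trivial

end Summit.NavierStokesRegularity.NavierStokesRegularity.Cruxes.FarPastLedger.Disproof
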